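import Summits.QuantumFields.YangMills.Theses.LangevinControlUV
import Summits.QuantumFields.YangMills.Theorems.TunedSequenceExists.Negative.Freezing
import Literature.MathematicalPhysics.QuantumLattice.GaugeGroupsProofs

/-!
# Disproof of `FemtoCurvatureTwoPoint` — standing adversary file (cdisprove gen 1 + gen 2 + gen 3)

Crux item `stmt-QuantumFields-9363`, decl
`Summit.QuantumFields.YangMills.Theses.LangevinControlUV.FemtoCurvatureTwoPoint`:
for every compact simple Lie `G` and faithful unitary `r` there are a unit map `a > 0`, `a → 0`,
a shape `Γ ∈ (0, 1]` on `(0, ℓ₀]` and `β₀, ℓ₀, c > 0, C` such that on every femto torus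
(`L · a(β) ≤ ℓ₀`, `β ≥ β₀`): (1) `c Γ(n a) ≤ n⁸ Cov(P_0^{01}, P_{ne₂}^{01}) ≤ C Γ(n a)` for
`1 ≤ n ≤ L/8`; (2) `|Cov(P_x^{ij}, P_y^{i'j'})| dist⁸ ≤ C Γ(dist · a)` for `x ≠ y`.

## Findings (index; every `theorem` is sorry-free unless it sits in `§ NearMisses`)

* `§ Defs`, `femtoCurvatureTwoPoint_iff` (`Iff.rfl`): the crux is
  `∀ G simple compact, ∀ r, PackageRho r.ρ`, with `PackageWith ρ a Γ β₀ ℓ₀ c C` the body at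
  fixed data — every lemma below is about ONE compact group and ONE continuous unitary `ρ`, so
  it needs no `IsCompactSimpleLieGroup` instance (none is provable in the tree today: the
  universal blocker for an unconditional `¬`, see `not_femtoCurvatureTwoPoint_of`).
* `§ Freezing`: `tendsto_cov_plaq` — on a FIXED torus every plaquette covariance tends to `0`
  as `β → ∞` (all compact `G`, all continuous unitary `ρ`; Laplace concentration on flat
  configurations, from the landed `TunedSequenceExists.Negative.Freezing`).
* `§ Consequences` (necessary conditions on ANY witness; each is a kill switch):
  `eventually_femto` (every torus is femto at all large `β` — the clauses are asymptotic
  statements on EVERY fixed torus), `eventually_axisCov_pos` (strict positivity of the axis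
  covariance on every `L ≥ 8n` eventually), `tendsto_gamma` (**forced asymptotic-freedom
  dividend**: `Γ(n a(β)) → 0`; hence `not_packageWith_of_gamma_ge`, `not_packageWith_const`:
  the constant-shape / bounded-below-shape strengthenings are FALSE for every `G, ρ`),
  `tendsto_gamma_nhdsWithin_zero` (under the proposed repair `MonotoneOn Γ`, `Γ(0⁺) = 0`),
  `eventually_ratio` (**the shared `Γ` couples small tori / all plane pairs to the axis pair at
  equal distance with ONE constant `C/c`**), `eventually_axis_comparable` (axis covariances at
  equal `(β, n)` comparable across all tori `L ∈ [8n, L₀]`).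
* `§ Dissection`: `ESFB ρ` (eventual shape-free bounds: positivity + cross-torus comparability +
  pair/axis ratio, ONE constant, NO rate) and `PackageWith.esfb` — all that the crux as typed
  constrains at `(G, ρ)`; kill switches `not_packageRho_of_ratio_blowup`,
  `not_packageRho_of_frequently_nonpos`; `PackageWith.c_le_C`.
* `§ UpperOnly`: `exists_upperOnlyWith` — **the crux with its LOWER bound deleted is a THEOREM**
  for every compact `G` and continuous unitary `ρ` (`Γ ≡ 1`, `C = 1`, slow step unit map from
  freezing thresholds): the lower bound `c Γ(n a) ≤ n⁸ Cov` is the unique load-bearing clause.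
* `§ LoadBearing`: `not_packageRho_one` (faithfulness of `r` is load-bearing, unconditionally,
  for every compact `G`), `not_unfaithful_of_isCompactSimpleLieGroup` / `not_unfaithful_of_su`
  (the unfaithful variant of the crux is false modulo the existence of one compact simple Lie
  group, resp. the tree's named fact `isSimpleCompactGroup_specialUnitaryGroup`),
  `not_femtoCurvatureTwoPoint_of` (refutation template).
* `§ Resists` (end of file): why no kill of the crux itself is in reach, what a kill must look
  like (a violation of `eventually_ratio` / `eventually_axisCov_pos` in the `β → ∞` asymptotics
  of ONE fixed small torus), the FINITE-GROUP KILL (PROVED in the landed chain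
  `Negative.FiniteGroup*`: `ConnectedSpace G` is load-bearing — the `Nontrivial`-variant of the
  crux is FALSE, witness `ℤ₂`; shared-link pair `Ω(ε⁶)` versus axis pair `O(ε⁸)`), and the status
  of the loophole (card generic-step-gamma-encoding: as typed the crux has no multiscale content).
* `§ Repairs` (gen 2, checked): what the two honest repairs add — `PackageWith.cross_comparable`
  (equal arguments `n a(β) = n' a(β')` ⇒ two-sided comparability of the rescaled axis covariances:
  the ONLY cross-`(β, n)` coupling of the crux as typed), `PackageWith.cross_monotone` (under
  `MonotoneOn Γ (Ioc 0 ℓ₀)`: ordered arguments ⇒ one-sided comparability — kills the parasitic slow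
  step maps; concrete form `PackageWith.no_fast_freezing_of_monotone`: at every later `β'` the
  rescaled covariance at `n' = ⌈a(β)/a(β')⌉` is `≥ (c/C)·Cov_{8,β}(1)`),
  `exists_later_level` + `PackageWith.rg_chain_of_continuous` (under `Continuous a`:
  EVERY pair `n < n'` is coupled, at every large `β`, to some later `β'` with `n' a(β') = n a(β)` —
  the RG-consistency skeleton that pins `a` to asymptotic-freedom scaling, § Resists item 6).
* `§ LoadBearing` (gen 2): `isCompactSimpleLieGroup_su` — `SU(n)`, `n ≥ 2`, satisfies the crux's
  group hypothesis UNCONDITIONALLY (tree `GaugeGroupsProofs`), so gen 1's "no instance, no `¬`"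
  blocker is gone: `not_femtoCurvatureTwoPoint_of_su` is the unconditional refutation template
  (one faithful `r` of one `SU(n)` violating `PackageRho`), and the unfaithful variant is now
  refuted unconditionally (`Negative.UnfaithfulFalseSU`, p110092).
* LANDED extracts (importable): `Negative.PlaquetteFreezing` (p73405), `Negative.UnfaithfulFalse`
  (p73420), `Negative.ForcedDividend` (p73903), `Negative.UpperOnly` (p73908), the finite-group
  chain `Negative.FiniteGroup{Peierls (p75654), Vortices (p76584), TwoPlaquettes (p77209),
  Bounds (p77898), Ratio (p79223)}`, drefute's `Negative.AxisLowerFiniteGroup` (p83506); gen 2: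
  `Negative.UnfaithfulFalseSU` (p110092), `Negative.FiniteGroupSharedLink` (p110484, explicit
  rates `Cov_axis ≤ M₁ε⁸`, `Cov_pair ≥ δ²ε⁶/2 − M₂ε⁸`), `Negative.AxisGaussianLowerFiniteGroup`
  (p110557, the line's open stub GD⁻ is false under `Nontrivial G`), and the CAPSTONE
  `Negative.FiniteGroupFalse` (`femtoCurvatureTwoPoint_nontrivial_false`, checked rc 0 in the
  refuter's folder; submitted once `FiniteGroupSharedLink` is built — INFRA NOTE: the tree module
  `Negative.FiniteGroupRatio` has been `remote:stale:…:unbuilt` on the hub for > 10 h, which is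
  why all six gen-1 capstone submissions bounced "gate restarted"; importers must use
  `FiniteGroupSharedLink`).
* `§ LineGSGE3` (gen 3): audit of the reshape-2 stubs of the picked line (RV, DBL, RPCS, CHESS, VAR,
  REST, GD-dom — see the section docblock: all consistent; CHESS/VAR's dyadic-evenness restriction on
  `L` is NECESSARY) and the parity identity `parity_prod_plaquetteHolonomy` /
  `pow_card_eq_one_of_const_plaquette` (abelian `G`: `∏_x U_{p(x;i,j)} = 1`, so a constant plane
  family `U_p ≡ g` forces `g^{L^d} = 1` — no fully frustrated `ℤ₂` plane family on an odd torus).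
* LANDED (gen 3): `Negative.ChessboardOddTorus` (p116010, ACCEPTED: `plaquetteChessboard_allTori_false`
  — the chessboard conclusion of `stub_chessboard_of_RPCS` / `stub_chessboardEven_of_RPCS` with the
  restriction on `L` dropped is FALSE, witness `ℤ₂`, `L = 3`; `chessboard_lhs_pos_rhs_zero` for every
  `β` and odd `L ≥ 3`); CAPSTONE `Negative.FiniteGroupFalse` re-filed as p115747
  (`femtoCurvatureTwoPoint_nontrivial_false` + `cruxBody_false_of_finite`, checked rc 0 / standard
  axioms as a self-contained twin; the filed 216-line version imports `FiniteGroupSharedLink`, whose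
  hub olean is still unbuilt, so the proposal is parked `farm-unavailable` until the build lands).
-/

noncomputable section

open scoped Matrix
open Filter Topology MeasureTheory
open Literature.MathematicalPhysics.QuantumFieldTheory Literature.MathematicalPhysics.QuantumLattice
open Summit.QuantumFields.YangMills.Theses.LangevinControlUV (FemtoCurvatureTwoPoint)
open Summit.QuantumFields.YangMills.Theorems.TunedSequenceExists.Negative.Freezing
  (tendsto_integral_wilsonMeasure re_trace_le_of_mem_unitaryGroup
    re_trace_eq_of_wilsonAction_eq_zero continuous_plaquetteHolonomy secondCountable_of_latticeRep)

namespace Summit.QuantumFields.YangMills.Cruxes.FemtoCurvatureTwoPoint.Disproof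

/-! ## § Defs — the crux body, unbundled at a fixed group and bare representation -/

section Defs

variable {G : Type} [Group G] [TopologicalSpace G] [IsTopologicalGroup G] [CompactSpace G]
  [MeasurableSpace G] [BorelSpace G] {N : ℕ}

/-- The plaquette field `P_x^{ij}(U) = N - Re tr ρ(U_{p(x;i,j)})` (the crux's `let P`). -/
def plaq (ρ : G →* Matrix (Fin N) (Fin N) ℂ) {L : ℕ} (x : Site 4 L) (i j : Fin 4)
    (U : GaugeConfig 4 L G) : ℝ :=
  (N : ℝ) - (ρ (plaquetteHolonomy U x i j)).trace.re

/-- Covariance under Wilson's measure (the crux's `let cov`, `let E`). -/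
def cov (ρ : G →* Matrix (Fin N) (Fin N) ℂ) {L : ℕ} [NeZero L] (β : ℝ)
    (F F' : GaugeConfig 4 L G → ℝ) : ℝ :=
  wilsonExpectation (d := 4) (L := L) ρ β (fun U => F U * F' U) -
    wilsonExpectation (d := 4) (L := L) ρ β F * wilsonExpectation (d := 4) (L := L) ρ β F'

/-- Torus Euclidean distance (the crux's `let dist`). -/
def tdist {L : ℕ} (x y : Site 4 L) : ℝ :=
  Real.sqrt (∑ k : Fin 4, (((x k - y k).valMinAbs : ℤ) : ℝ) ^ 2)

/-- The reference axis covariance `Cov(P_0^{01}, P_{n e₂}^{01})` on the torus of side `L`. -/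
def axisCov (ρ : G →* Matrix (Fin N) (Fin N) ℂ) (L : ℕ) [NeZero L] (β : ℝ) (n : ℕ) : ℝ :=
  cov ρ β (plaq ρ (0 : Site 4 L) 0 1) (plaq ρ (Pi.single (2 : Fin 4) ((n : ℕ) : ZMod L)) 0 1)

/-- The two clauses of the crux on ONE torus at ONE coupling, for data `(a, Γ, c, C)`. -/
def Clauses (ρ : G →* Matrix (Fin N) (Fin N) ℂ) (a Γ : ℝ → ℝ) (c C : ℝ) (L : ℕ) [NeZero L]
    (β : ℝ) : Prop :=
  (∀ n : ℕ, 1 ≤ n → 8 * n ≤ L →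
      c * Γ ((n : ℝ) * a β) ≤ (n : ℝ) ^ 8 * axisCov ρ L β n ∧
        (n : ℝ) ^ 8 * axisCov ρ L β n ≤ C * Γ ((n : ℝ) * a β)) ∧
    ∀ (x y : Site 4 L) (i j i' j' : Fin 4), x ≠ y → i ≠ j → i' ≠ j' →
      |cov ρ β (plaq ρ x i j) (plaq ρ y i' j')| * tdist x y ^ 8 ≤ C * Γ (tdist x y * a β)

/-- The crux package for a bare representation `ρ` with explicit data
`(a, Γ, β₀, ℓ₀, c, C)`: side conditions and the clauses on every femto torus. -/
def PackageWith (ρ : G →* Matrix (Fin N) (Fin N) ℂ) (a Γ : ℝ → ℝ) (β₀ ℓ₀ c C : ℝ) : Prop :=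
  0 < ℓ₀ ∧ 0 < c ∧ (∀ β, 0 < a β) ∧ Tendsto a atTop (𝓝 0) ∧
    (∀ s : ℝ, 0 < s → s ≤ ℓ₀ → 0 < Γ s ∧ Γ s ≤ 1) ∧
      ∀ (L : ℕ) [NeZero L] (β : ℝ), β₀ ≤ β → (L : ℝ) * a β ≤ ℓ₀ → Clauses ρ a Γ c C L β

/-- The crux AT a fixed compact group and bare representation `ρ` (`∃` data). -/
def PackageRho (ρ : G →* Matrix (Fin N) (Fin N) ℂ) : Prop :=
  ∃ (a : ℝ → ℝ), ∃ (Γ : ℝ → ℝ) (β₀ ℓ₀ c C : ℝ), PackageWith ρ a Γ β₀ ℓ₀ c C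

end Defs

/-- The crux is literally `∀ G simple compact, ∀ r : LatticeRep G, PackageRho r.ρ`
(definitional unbundling; Borel σ-algebra as in the crux). -/
theorem femtoCurvatureTwoPoint_iff :
    FemtoCurvatureTwoPoint ↔
      ∀ (G : Type) [Group G] [TopologicalSpace G] [IsTopologicalGroup G] [CompactSpace G],
        IsCompactSimpleLieGroup G →
          letI : MeasurableSpace G := borel G
          haveI : BorelSpace G := ⟨rfl⟩
          ∀ r : LatticeRep G, PackageRho r.ρ :=
  Iff.rfl


/-! ## § Basic — elementary facts about the plaquette field -/

section Basic

variable {G : Type} [Group G] [TopologicalSpace G] [IsTopologicalGroup G] [CompactSpace G]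
  [MeasurableSpace G] [BorelSpace G] {N : ℕ} (ρ : G →* Matrix (Fin N) (Fin N) ℂ)

omit [TopologicalSpace G] [IsTopologicalGroup G] [CompactSpace G] [MeasurableSpace G]
  [BorelSpace G] in
/-- Exchanging the two directions inverts the plaquette holonomy. -/
theorem plaquetteHolonomy_swap' {L : ℕ} (U : GaugeConfig 4 L G) (x : Site 4 L) (i j : Fin 4) :
    plaquetteHolonomy U x j i = (plaquetteHolonomy U x i j)⁻¹ := by
  simp only [plaquetteHolonomy, mul_inv_rev, inv_inv, mul_assoc]

omit [TopologicalSpace G] [IsTopologicalGroup G] [CompactSpace G] [MeasurableSpace G]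
  [BorelSpace G] in
/-- The degenerate plaquette `i = j` has trivial holonomy. -/
theorem plaquetteHolonomy_self' {L : ℕ} (U : GaugeConfig 4 L G) (x : Site 4 L) (i : Fin 4) :
    plaquetteHolonomy U x i i = 1 := by
  simp [plaquetteHolonomy]

omit [TopologicalSpace G] [IsTopologicalGroup G] [CompactSpace G] [MeasurableSpace G]
  [BorelSpace G] in
/-- `Re tr ρ(h⁻¹) = Re tr ρ(h)` for a unitary representation. -/
theorem re_trace_map_inv' (hρu : ∀ g, ρ g ∈ Matrix.unitaryGroup (Fin N) ℂ) (h : G) :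
    (ρ h⁻¹).trace.re = (ρ h).trace.re := by
  have h1 : ρ h * (ρ h)ᴴ = 1 := by
    rw [← Matrix.star_eq_conjTranspose]; exact Matrix.mem_unitaryGroup_iff.1 (hρu h)
  have h2 : ρ h⁻¹ = (ρ h)ᴴ := by
    calc ρ h⁻¹ = ρ h⁻¹ * (ρ h * (ρ h)ᴴ) := by rw [h1, mul_one]
      _ = (ρ h)ᴴ := by rw [← mul_assoc, ← map_mul, inv_mul_cancel, map_one, one_mul]
  rw [h2, Matrix.trace_conjTranspose, Complex.star_def, Complex.conj_re]

omit [TopologicalSpace G] [IsTopologicalGroup G] [CompactSpace G] [MeasurableSpace G]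
  [BorelSpace G] in
/-- `|Re tr M| ≤ N` for a unitary `N × N` matrix. -/
theorem abs_re_trace_le_of_mem_unitaryGroup {M : Matrix (Fin N) (Fin N) ℂ}
    (hM : M ∈ Matrix.unitaryGroup (Fin N) ℂ) : |M.trace.re| ≤ N := by
  calc |M.trace.re| ≤ ‖M.trace‖ := Complex.abs_re_le_norm _
    _ = ‖∑ i, M i i‖ := rfl
    _ ≤ ∑ i, ‖M i i‖ := norm_sum_le _ _
    _ ≤ ∑ _i : Fin N, (1 : ℝ) := Finset.sum_le_sum fun i _ => entry_norm_bound_of_unitary hM i i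
    _ = N := by simp

omit [TopologicalSpace G] [IsTopologicalGroup G] [CompactSpace G] [MeasurableSpace G]
  [BorelSpace G] in
/-- `P_x^{ji} = P_x^{ij}` (unitary `ρ`): the orientation of the plaquette is immaterial. -/
theorem plaq_swap (hρu : ∀ g, ρ g ∈ Matrix.unitaryGroup (Fin N) ℂ) {L : ℕ} (x : Site 4 L)
    (i j : Fin 4) : plaq ρ x j i = plaq ρ x i j := by
  funext U
  simp only [plaq, plaquetteHolonomy_swap' U x i j, re_trace_map_inv' ρ hρu]

omit [TopologicalSpace G] [IsTopologicalGroup G] [CompactSpace G] [MeasurableSpace G]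
  [BorelSpace G] in
/-- The degenerate plaquette field `P_x^{ii}` vanishes identically. -/
theorem plaq_self {L : ℕ} (x : Site 4 L) (i : Fin 4) : plaq ρ x i i = 0 := by
  funext U
  simp [plaq, plaquetteHolonomy_self', Matrix.trace_one]

omit [TopologicalSpace G] [IsTopologicalGroup G] [CompactSpace G] [MeasurableSpace G]
  [BorelSpace G] in
/-- `0 ≤ P ≤ 2N` (unitary `ρ`). -/
theorem plaq_nonneg (hρu : ∀ g, ρ g ∈ Matrix.unitaryGroup (Fin N) ℂ) {L : ℕ} (x : Site 4 L)
    (i j : Fin 4) (U : GaugeConfig 4 L G) : 0 ≤ plaq ρ x i j U :=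
  sub_nonneg.2 (re_trace_le_of_mem_unitaryGroup (hρu _))

omit [TopologicalSpace G] [IsTopologicalGroup G] [CompactSpace G] [MeasurableSpace G]
  [BorelSpace G] in
theorem plaq_le (hρu : ∀ g, ρ g ∈ Matrix.unitaryGroup (Fin N) ℂ) {L : ℕ} (x : Site 4 L)
    (i j : Fin 4) (U : GaugeConfig 4 L G) : plaq ρ x i j U ≤ 2 * N := by
  have h := (abs_le.1 (abs_re_trace_le_of_mem_unitaryGroup (hρu (plaquetteHolonomy U x i j)))).1
  unfold plaq
  linarith

omit [TopologicalSpace G] [IsTopologicalGroup G] [CompactSpace G] [MeasurableSpace G]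
  [BorelSpace G] in
/-- On FLAT configurations (zero Wilson action) every plaquette field vanishes — all
orientations, including the degenerate and the reversed ones. -/
theorem plaq_eq_zero_of_flat (hρu : ∀ g, ρ g ∈ Matrix.unitaryGroup (Fin N) ℂ) {L : ℕ} [NeZero L]
    {U : GaugeConfig 4 L G} (hU : wilsonAction ρ U = 0) (x : Site 4 L) (i j : Fin 4) :
    plaq ρ x i j U = 0 := by
  have hρN : ∀ g, (ρ g).trace.re ≤ N := fun g => re_trace_le_of_mem_unitaryGroup (hρu g)
  rcases lt_trichotomy i j with hij | rfl | hji
  · simp only [plaq, re_trace_eq_of_wilsonAction_eq_zero ρ hρN hU x i j hij, sub_self]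
  · simp only [plaq_self]; rfl
  · rw [← plaq_swap ρ hρu]
    simp only [plaq, re_trace_eq_of_wilsonAction_eq_zero ρ hρN hU x j i hji, sub_self]

omit [CompactSpace G] [MeasurableSpace G] [BorelSpace G] in
/-- The plaquette field is continuous (continuous `ρ`). -/
theorem continuous_plaq (hρ : Continuous ρ) {L : ℕ} (x : Site 4 L) (i j : Fin 4) :
    Continuous (plaq ρ x i j) :=
  continuous_const.sub ((continuous_trace_re ρ hρ).comp (continuous_plaquetteHolonomy x i j))

omit [TopologicalSpace G] [IsTopologicalGroup G] [CompactSpace G] [MeasurableSpace G]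
  [BorelSpace G] in
/-- The trivial representation has identically vanishing plaquette field. -/
theorem plaq_one {L : ℕ} (x : Site 4 L) (i j : Fin 4) :
    plaq (1 : G →* Matrix (Fin N) (Fin N) ℂ) x i j = 0 := by
  funext U
  simp [plaq, Matrix.trace_one]

/-- A covariance with the zero observable vanishes (whatever the measure). -/
theorem cov_zero_left {L : ℕ} [NeZero L] (β : ℝ) (F' : GaugeConfig 4 L G → ℝ) :
    cov ρ β (0 : GaugeConfig 4 L G → ℝ) F' = 0 := by
  simp [cov, wilsonExpectation]

end Basic

/-! ## § Freezing — on a FIXED torus every plaquette covariance dies as `β → ∞` -/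

section Freezing

variable {G : Type} [Group G] [TopologicalSpace G] [IsTopologicalGroup G] [CompactSpace G]
  [MeasurableSpace G] [BorelSpace G] [SecondCountableTopology G] {N : ℕ}
  (ρ : G →* Matrix (Fin N) (Fin N) ℂ)

/-- `⟨P_x^{ij}⟩_{L,β} → 0` as `β → ∞` on a fixed torus (Laplace concentration on flat
configurations, tree lemma `tendsto_integral_wilsonMeasure`). -/
theorem tendsto_wilsonExpectation_plaq (hρ : Continuous ρ)
    (hρu : ∀ g, ρ g ∈ Matrix.unitaryGroup (Fin N) ℂ) {L : ℕ} [NeZero L] (x : Site 4 L)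
    (i j : Fin 4) :
    Tendsto (fun β : ℝ => wilsonExpectation (d := 4) (L := L) ρ β (plaq ρ x i j)) atTop (𝓝 0) :=
  tendsto_integral_wilsonMeasure ρ hρ (fun g => re_trace_le_of_mem_unitaryGroup (hρu g))
    (continuous_plaq ρ hρ x i j) fun _ hU => plaq_eq_zero_of_flat ρ hρu hU x i j

/-- **Freezing of plaquette covariances.** On a fixed torus `(ℤ/L)⁴`, for every compact `G` and
continuous unitary `ρ`, `Cov_{L,β}(P_x^{ij}, P_y^{i'j'}) → 0` as `β → ∞`. -/
theorem tendsto_cov_plaq (hρ : Continuous ρ) (hρu : ∀ g, ρ g ∈ Matrix.unitaryGroup (Fin N) ℂ)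
    {L : ℕ} [NeZero L] (x y : Site 4 L) (i j i' j' : Fin 4) :
    Tendsto (fun β : ℝ => cov ρ β (plaq ρ x i j) (plaq ρ y i' j')) atTop (𝓝 0) := by
  have h1 := tendsto_integral_wilsonMeasure ρ hρ (fun g => re_trace_le_of_mem_unitaryGroup (hρu g))
    ((continuous_plaq ρ hρ x i j).mul (continuous_plaq ρ hρ y i' j')) (c := 0)
    fun U hU => by simp [plaq_eq_zero_of_flat ρ hρu hU]
  have h2 := tendsto_wilsonExpectation_plaq ρ hρ hρu x i j
  have h3 := tendsto_wilsonExpectation_plaq ρ hρ hρu y i' j'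
  have h := h1.sub (h2.mul h3)
  simpa [cov, wilsonExpectation] using h

/-- In particular the reference axis covariance dies: `Cov_{L,β}(P_0^{01}, P_{ne₂}^{01}) → 0`. -/
theorem tendsto_axisCov (hρ : Continuous ρ) (hρu : ∀ g, ρ g ∈ Matrix.unitaryGroup (Fin N) ℂ)
    (L : ℕ) [NeZero L] (n : ℕ) : Tendsto (fun β : ℝ => axisCov ρ L β n) atTop (𝓝 0) :=
  tendsto_cov_plaq ρ hρ hρu _ _ _ _ _ _

end Freezing

/-! ## § Consequences — what any witness `(a, Γ, β₀, ℓ₀, c, C)` of the package must satisfy -/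

section Consequences

variable {G : Type} [Group G] [TopologicalSpace G] [IsTopologicalGroup G] [CompactSpace G]
  [MeasurableSpace G] [BorelSpace G] {N : ℕ} {ρ : G →* Matrix (Fin N) (Fin N) ℂ}
  {a Γ : ℝ → ℝ} {β₀ ℓ₀ c C : ℝ}

/-- Every torus is eventually femto: `a → 0` puts `(ℤ/L)⁴` inside the physical box `ℓ₀` for all
large `β` (so the clauses must hold on EVERY torus at all sufficiently large couplings). -/
theorem PackageWith.eventually_femto (h : PackageWith ρ a Γ β₀ ℓ₀ c C) (L : ℕ) :
    ∀ᶠ β in atTop, β₀ ≤ β ∧ (L : ℝ) * a β ≤ ℓ₀ := by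
  obtain ⟨hℓ, -, ha, hat, -, -⟩ := h
  have h2 : ∀ᶠ β in atTop, a β < ℓ₀ / ((L : ℝ) + 1) :=
    hat (Iio_mem_nhds (div_pos hℓ (by positivity)))
  filter_upwards [eventually_ge_atTop β₀, h2] with β hβ hβ'
  refine ⟨hβ, ?_⟩
  have h3 : a β * ((L : ℝ) + 1) < ℓ₀ := (lt_div_iff₀ (by positivity)).1 hβ'
  nlinarith [ha β]

/-- The argument `n · a(β)` of `Γ` is eventually inside `(0, ℓ₀]`. -/
theorem PackageWith.eventually_arg_mem (h : PackageWith ρ a Γ β₀ ℓ₀ c C) {n : ℕ} (hn : 1 ≤ n) :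
    ∀ᶠ β in atTop, 0 < (n : ℝ) * a β ∧ (n : ℝ) * a β ≤ ℓ₀ := by
  filter_upwards [h.eventually_femto n] with β hβ
  have hn' : (0 : ℝ) < n := by exact_mod_cast hn
  exact ⟨mul_pos hn' (h.2.2.1 β), hβ.2⟩

/-- **Lower bound ⇒ eventual strict positivity** of the axis covariance on EVERY torus
`L ≥ 8n`, at all large `β` (the sign is supplied for free by transfer-matrix positivity — card
cosh-mixture-convexity — but STRICT positivity with an `L`-uniform floor is content). -/
theorem PackageWith.eventually_axisCov_pos (h : PackageWith ρ a Γ β₀ ℓ₀ c C) {n L : ℕ} [NeZero L]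
    (hn : 1 ≤ n) (hL : 8 * n ≤ L) : ∀ᶠ β in atTop, 0 < axisCov ρ L β n := by
  filter_upwards [h.eventually_femto L, h.eventually_arg_mem hn] with β hβ hs
  have hlow := ((h.2.2.2.2.2 L β hβ.1 hβ.2).1 n hn hL).1
  have hΓ := (h.2.2.2.2.1 _ hs.1 hs.2).1
  have hcΓ : 0 < c * Γ ((n : ℝ) * a β) := mul_pos h.2.1 hΓ
  have hn8 : (0 : ℝ) < (n : ℝ) ^ 8 := by positivity
  by_contra hneg
  have hneg' : axisCov ρ L β n ≤ 0 := not_lt.1 hneg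
  nlinarith

/-- **Freezing forces the asymptotic-freedom dividend**: for every witness, `Γ(n·a(β)) → 0` as
`β → ∞` for each fixed `n ≥ 1` — the lower bound on the torus `L = 8n` (eventually femto) is
squeezed by `Cov_{8n,β} → 0`. In particular `Γ` cannot be bounded below on `(0, ℓ₀]`
(`not_packageWith_of_gamma_ge`): the scale-invariant ("conformal", `Γ ≍ 1`) form of the crux
is FALSE for every compact `G` and every continuous unitary `ρ`. -/
theorem PackageWith.tendsto_gamma [SecondCountableTopology G] (h : PackageWith ρ a Γ β₀ ℓ₀ c C)
    (hρ : Continuous ρ) (hρu : ∀ g, ρ g ∈ Matrix.unitaryGroup (Fin N) ℂ) {n : ℕ} (hn : 1 ≤ n) :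
    Tendsto (fun β : ℝ => Γ ((n : ℝ) * a β)) atTop (𝓝 0) := by
  haveI : NeZero (8 * n) := ⟨by omega⟩
  have hc := h.2.1
  have hup : Tendsto (fun β : ℝ => (n : ℝ) ^ 8 / c * axisCov ρ (8 * n) β n) atTop (𝓝 0) := by
    simpa using (tendsto_axisCov ρ hρ hρu (8 * n) n).const_mul ((n : ℝ) ^ 8 / c)
  refine tendsto_of_tendsto_of_tendsto_of_le_of_le' tendsto_const_nhds hup ?_ ?_
  · filter_upwards [h.eventually_arg_mem hn] with β hs
    exact (h.2.2.2.2.1 _ hs.1 hs.2).1.le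
  · filter_upwards [h.eventually_femto (8 * n)] with β hβ
    have hlow := ((h.2.2.2.2.2 (8 * n) β hβ.1 hβ.2).1 n hn le_rfl).1
    rw [div_mul_eq_mul_div, le_div_iff₀ hc]
    linarith

/-- `Γ` cannot be bounded below by a positive constant on `(0, ℓ₀]`. -/
theorem not_packageWith_of_gamma_ge [SecondCountableTopology G] (hρ : Continuous ρ)
    (hρu : ∀ g, ρ g ∈ Matrix.unitaryGroup (Fin N) ℂ) {γ₀ : ℝ} (hγ : 0 < γ₀)
    (hΓ : ∀ s : ℝ, 0 < s → s ≤ ℓ₀ → γ₀ ≤ Γ s) : ¬ PackageWith ρ a Γ β₀ ℓ₀ c C := fun h => by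
  have h1 : ∀ᶠ β in atTop, Γ ((1 : ℕ) * a β) < γ₀ :=
    (h.tendsto_gamma hρ hρu le_rfl) (Iio_mem_nhds hγ)
  obtain ⟨β, hβ1, hs⟩ := (h1.and (h.eventually_arg_mem le_rfl)).exists
  have := hΓ _ hs.1 hs.2
  linarith

/-- **Refuted strengthening (constant shape).** No compact `G`, continuous unitary `ρ` and data
admit the package with a CONSTANT shape function `Γ ≡ γ`: two-sided bounds
`c ≤ n⁸ Cov ≤ C` of free-field shape are impossible (freezing at fixed `L`). -/
theorem not_packageWith_const [SecondCountableTopology G] (hρ : Continuous ρ)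
    (hρu : ∀ g, ρ g ∈ Matrix.unitaryGroup (Fin N) ℂ) (γ : ℝ) :
    ¬ PackageWith ρ a (fun _ => γ) β₀ ℓ₀ c C := fun h =>
  not_packageWith_of_gamma_ge hρ hρu (h.2.2.2.2.1 ℓ₀ h.1 le_rfl).1 (fun _ _ _ => le_rfl) h

/-- **Under the proposed repair `MonotoneOn Γ (Ioc 0 ℓ₀)`** (card generic-step-gamma-encoding,
retriage-g2) the dividend becomes genuine: `Γ(s) → 0` as `s → 0⁺`. (So a repaired crux asserts
asymptotic freedom of the curvature two-point function outright; recorded for the planner.) -/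
theorem PackageWith.tendsto_gamma_nhdsWithin_zero [SecondCountableTopology G]
    (h : PackageWith ρ a Γ β₀ ℓ₀ c C) (hρ : Continuous ρ)
    (hρu : ∀ g, ρ g ∈ Matrix.unitaryGroup (Fin N) ℂ) (hmono : MonotoneOn Γ (Set.Ioc 0 ℓ₀)) :
    Tendsto Γ (𝓝[>] 0) (𝓝 0) := by
  rw [Metric.tendsto_nhdsWithin_nhds]
  intro ε hε
  have h1 : ∀ᶠ β in atTop, Γ ((1 : ℕ) * a β) < ε := (h.tendsto_gamma hρ hρu le_rfl) (Iio_mem_nhds hε)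
  obtain ⟨β, hβ1, hs⟩ := (h1.and (h.eventually_arg_mem le_rfl)).exists
  simp only [Nat.cast_one, one_mul] at hβ1 hs
  refine ⟨a β, hs.1, fun s hs0 hsd => ?_⟩
  simp only [Set.mem_Ioi] at hs0
  rw [Real.dist_eq, sub_zero] at hsd ⊢
  have hsle : s ≤ a β := by
    have := (abs_lt.1 hsd).2; linarith
  have hΓs := h.2.2.2.2.1 s hs0 (hsle.trans hs.2)
  have hmon : Γ s ≤ Γ (a β) := hmono ⟨hs0, hsle.trans hs.2⟩ ⟨hs.1, hs.2⟩ hsle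
  rw [abs_of_pos hΓs.1]
  linarith

/-- **The shared shape couples tori and plane pairs (ratio bound).** For every witness there is
ONE constant `K = C/c` such that, for every ceiling `L₀`, at all large `β`: every plaquette pair
at torus distance `n` on ANY torus `L' ≤ L₀` is dominated by the reference axis covariance at
separation `n` on ANY torus `L ∈ [8n, L₀]` — same `β`, no `n⁸` left. A numerical or semiclassical
violation of this (e.g. anomalous zero-mode scaling on a small torus `L' = 2, 3` versus `L = 8`,
or a shared-link pair versus the axis pair) refutes the crux: `not_packageWith_of_ratio`. -/
theorem PackageWith.eventually_ratio (h : PackageWith ρ a Γ β₀ ℓ₀ c C) (L₀ : ℕ) :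
    ∀ᶠ β in atTop, ∀ (L L' : ℕ) [NeZero L] [NeZero L'] (n : ℕ) (x y : Site 4 L')
      (i j i' j' : Fin 4), 1 ≤ n → 8 * n ≤ L → L ≤ L₀ → L' ≤ L₀ → x ≠ y → i ≠ j → i' ≠ j' →
        tdist x y = n → |cov ρ β (plaq ρ x i j) (plaq ρ y i' j')| ≤ C / c * axisCov ρ L β n := by
  filter_upwards [h.eventually_femto L₀] with β hβ L L' _ _ n x y i j i' j' hn hnL hL hL' hxy hij
    hij' hd
  obtain ⟨hℓ, hc, ha, -, hΓ, hcl⟩ := h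
  have haβ := (ha β).le
  have hLβ : (L : ℝ) * a β ≤ ℓ₀ :=
    (mul_le_mul_of_nonneg_right (Nat.cast_le.2 hL) haβ).trans hβ.2
  have hL'β : (L' : ℝ) * a β ≤ ℓ₀ :=
    (mul_le_mul_of_nonneg_right (Nat.cast_le.2 hL') haβ).trans hβ.2
  have h1 := ((hcl L β hβ.1 hLβ).1 n hn hnL).1
  have h2 := (hcl L' β hβ.1 hL'β).2 x y i j i' j' hxy hij hij'
  rw [hd] at h2
  have hn' : (0 : ℝ) < n := by exact_mod_cast hn
  have hs : 0 < (n : ℝ) * a β ∧ (n : ℝ) * a β ≤ ℓ₀ :=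
    ⟨mul_pos hn' (ha β), (mul_le_mul_of_nonneg_right
      (show (n : ℝ) ≤ L by exact_mod_cast (by omega : n ≤ L)) haβ).trans hLβ⟩
  have hΓpos := (hΓ _ hs.1 hs.2).1
  have hn8 : (0 : ℝ) < (n : ℝ) ^ 8 := by positivity
  have habs : 0 ≤ |cov ρ β (plaq ρ x i j) (plaq ρ y i' j')| := abs_nonneg _
  have hC : 0 ≤ C := by
    by_contra hC
    have hC' : C < 0 := not_le.1 hC
    nlinarith [mul_nonneg habs hn8.le]
  have h3 : C * Γ ((n : ℝ) * a β) ≤ C / c * ((n : ℝ) ^ 8 * axisCov ρ L β n) := by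
    rw [div_mul_eq_mul_div, le_div_iff₀ hc]
    nlinarith
  refine le_of_mul_le_mul_right ?_ hn8
  nlinarith


/-- **Axis covariances are comparable across tori** (same `β`, same `n`): for every witness,
eventually `c · Cov_{L'} ≤ C · Cov_L`-type comparability holds for all `L, L' ∈ [8n, L₀]`. -/
theorem PackageWith.eventually_axis_comparable (h : PackageWith ρ a Γ β₀ ℓ₀ c C) (L₀ : ℕ) :
    ∀ᶠ β in atTop, ∀ (L L' : ℕ) [NeZero L] [NeZero L'] (n : ℕ), 1 ≤ n → 8 * n ≤ L → 8 * n ≤ L' →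
      L ≤ L₀ → L' ≤ L₀ → c * axisCov ρ L' β n ≤ C * axisCov ρ L β n := by
  filter_upwards [h.eventually_femto L₀] with β hβ L L' _ _ n hn hnL hnL' hL hL'
  obtain ⟨hℓ, hc, ha, -, hΓ, hcl⟩ := h
  have haβ := (ha β).le
  have hLβ : (L : ℝ) * a β ≤ ℓ₀ :=
    (mul_le_mul_of_nonneg_right (Nat.cast_le.2 hL) haβ).trans hβ.2
  have hL'β : (L' : ℝ) * a β ≤ ℓ₀ :=
    (mul_le_mul_of_nonneg_right (Nat.cast_le.2 hL') haβ).trans hβ.2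
  have h1 := ((hcl L β hβ.1 hLβ).1 n hn hnL).1
  have h2 := ((hcl L' β hβ.1 hL'β).1 n hn hnL').2
  have hn' : (0 : ℝ) < n := by exact_mod_cast hn
  have hs : 0 < (n : ℝ) * a β ∧ (n : ℝ) * a β ≤ ℓ₀ :=
    ⟨mul_pos hn' (ha β), (mul_le_mul_of_nonneg_right
      (show (n : ℝ) ≤ L by exact_mod_cast (by omega : n ≤ L)) haβ).trans hLβ⟩
  have hΓpos := (hΓ _ hs.1 hs.2).1
  have hn8 : (0 : ℝ) < (n : ℝ) ^ 8 := by positivity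
  -- c Γ ≤ n⁸ Cov_L and n⁸ Cov_{L'} ≤ C Γ, hence c n⁸ Cov_{L'} ≤ C c Γ · ... combine
  have hC : 0 ≤ C := by
    by_contra hC
    have hC' : C < 0 := not_le.1 hC
    have hpos' : 0 < axisCov ρ L' β n := by
      have := ((hcl L' β hβ.1 hL'β).1 n hn hnL').1
      by_contra hneg
      have hneg' : axisCov ρ L' β n ≤ 0 := not_lt.1 hneg
      nlinarith [mul_pos hc hΓpos]
    nlinarith [mul_pos hn8 hpos']
  have key : c * ((n : ℝ) ^ 8 * axisCov ρ L' β n) ≤ C * ((n : ℝ) ^ 8 * axisCov ρ L β n) := by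
    calc c * ((n : ℝ) ^ 8 * axisCov ρ L' β n) ≤ c * (C * Γ ((n : ℝ) * a β)) :=
          mul_le_mul_of_nonneg_left h2 hc.le
      _ = C * (c * Γ ((n : ℝ) * a β)) := by ring
      _ ≤ C * ((n : ℝ) ^ 8 * axisCov ρ L β n) := mul_le_mul_of_nonneg_left h1 hC
  refine le_of_mul_le_mul_right ?_ hn8
  nlinarith

end Consequences

/-! ## § Dissection — the crux at `(G, ρ)` implies EVENTUAL SHAPE-FREE BOUNDS (no rate, no scale) -/

section Dissection

variable {G : Type} [Group G] [TopologicalSpace G] [IsTopologicalGroup G] [CompactSpace G]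
  [MeasurableSpace G] [BorelSpace G] {N : ℕ} {ρ : G →* Matrix (Fin N) (Fin N) ℂ}
  {a Γ : ℝ → ℝ} {β₀ ℓ₀ c C : ℝ}

variable (ρ) in
/-- **Eventual shape-free bounds** at `(G, ρ)`: ONE constant `K` such that for every ceiling `L₀`,
at all sufficiently large `β`, simultaneously on all tori `L, L' ≤ L₀`: (i) the axis covariance at
every admissible separation is strictly positive, (ii) axis covariances at equal `(β, n)` are
comparable across tori within `K`, (iii) every plaquette pair at torus distance `n` is dominated
by `K ×` the axis covariance at separation `n`. No unit map, no shape function, no rate in `β` or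
`n`: this is all the crux as typed constrains (`PackageWith.esfb`); conversely a refined
generic-valued step unit map encodes `ESFB` back into the crux (card generic-step-gamma-encoding;
the encoding direction is a prover's job and is not carried out here). A refutation of the crux at
`(G, ρ)` is therefore EXACTLY a failure of `ESFB ρ`, i.e. of (i), (ii) or (iii) in the `β → ∞`
asymptotics of finitely many fixed tori. -/
def ESFB : Prop :=
  ∃ K : ℝ, 0 < K ∧ ∀ L₀ : ℕ, ∀ᶠ β : ℝ in atTop,
    ∀ (L L' : ℕ) [NeZero L] [NeZero L'] (n : ℕ), 1 ≤ n → 8 * n ≤ L → L ≤ L₀ → L' ≤ L₀ →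
      0 < axisCov ρ L β n ∧
        (8 * n ≤ L' → axisCov ρ L' β n ≤ K * axisCov ρ L β n) ∧
          ∀ (x y : Site 4 L') (i j i' j' : Fin 4), x ≠ y → i ≠ j → i' ≠ j' → tdist x y = n →
            |cov ρ β (plaq ρ x i j) (plaq ρ y i' j')| ≤ K * axisCov ρ L β n

/-- Any witness has `0 < c ≤ C` (lower ≤ upper on the torus `L = 8`, eventually femto). -/
theorem PackageWith.c_le_C (h : PackageWith ρ a Γ β₀ ℓ₀ c C) : c ≤ C := by
  haveI : NeZero (8 : ℕ) := ⟨by norm_num⟩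
  obtain ⟨β, hβ, hs⟩ := ((h.eventually_femto 8).and (h.eventually_arg_mem le_rfl)).exists
  have h1 := (h.2.2.2.2.2 8 β hβ.1 hβ.2).1 1 le_rfl (by norm_num)
  have hΓ := (h.2.2.2.2.1 _ hs.1 hs.2).1
  exact le_of_mul_le_mul_right (h1.1.trans h1.2) hΓ

/-- **Dissection (necessary half).** The crux package at `(G, ρ)` implies the eventual shape-free
bounds with `K = C/c`. -/
theorem PackageWith.esfb (h : PackageWith ρ a Γ β₀ ℓ₀ c C) : ESFB ρ := by
  have hc := h.2.1
  have hK : 0 < C / c := div_pos (hc.trans_le h.c_le_C) hc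
  refine ⟨C / c, hK, fun L₀ => ?_⟩
  filter_upwards [h.eventually_femto L₀, h.eventually_axis_comparable L₀, h.eventually_ratio L₀]
    with β hβ hcomp hratio L L' _ _ n hn hnL hL hL'
  obtain ⟨hℓ, -, ha, -, hΓ, hcl⟩ := h
  have haβ := (ha β).le
  have hLβ : (L : ℝ) * a β ≤ ℓ₀ :=
    (mul_le_mul_of_nonneg_right (Nat.cast_le.2 hL) haβ).trans hβ.2
  have hn' : (0 : ℝ) < n := by exact_mod_cast hn
  have hs : 0 < (n : ℝ) * a β ∧ (n : ℝ) * a β ≤ ℓ₀ :=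
    ⟨mul_pos hn' (ha β), (mul_le_mul_of_nonneg_right
      (show (n : ℝ) ≤ L by exact_mod_cast (by omega : n ≤ L)) haβ).trans hLβ⟩
  have hpos : 0 < axisCov ρ L β n := by
    have hlow := ((hcl L β hβ.1 hLβ).1 n hn hnL).1
    have hcΓ : 0 < c * Γ ((n : ℝ) * a β) := mul_pos hc (hΓ _ hs.1 hs.2).1
    have hn8 : (0 : ℝ) < (n : ℝ) ^ 8 := by positivity
    by_contra hneg
    have hneg' : axisCov ρ L β n ≤ 0 := not_lt.1 hneg
    nlinarith
  refine ⟨hpos, fun hnL' => ?_, fun x y i j i' j' hxy hij hij' hd =>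
    hratio L L' n x y i j i' j' hn hnL hL hL' hxy hij hij' hd⟩
  have := hcomp L L' n hn hnL hnL' hL hL'
  rw [div_mul_eq_mul_div, le_div_iff₀ hc]
  linarith

/-- **Kill switch (ratio blow-up).** If at `(G, ρ)` some plaquette pair at torus distance `n` on
a torus `L'` beats every multiple of the axis covariance at separation `n` on a torus `L ≥ 8n`
frequently as `β → ∞`, the crux fails at `(G, ρ)`. This is the mechanism that kills FINITE gauge
groups (for `ℤ₂`: `x = 0`, `(i,j) = (0,2)`, `y = e₂`, `(i',j') = (0,1)` share the link `(e₂, 0)`,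
`Cov = Θ(e^{-12β})`, against the axis pair `Θ(e^{-20β})`, `L = L' = 8`, `n = 1`), and the one a
Monte-Carlo / semiclassical search must exhibit for `SU(N)` (not expected: both sides are
`Θ(β⁻²)` for a Lie group, and `|Cov(P, P')| ≤ Var P` by Cauchy–Schwarz and plane/site symmetry). -/
theorem not_packageRho_of_ratio_blowup {L L' : ℕ} [NeZero L] [NeZero L'] {n : ℕ} (hn : 1 ≤ n)
    (hnL : 8 * n ≤ L) {x y : Site 4 L'} {i j i' j' : Fin 4} (hxy : x ≠ y) (hij : i ≠ j)
    (hij' : i' ≠ j') (hd : tdist x y = n)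
    (hblow : ∀ K : ℝ, ∃ᶠ β : ℝ in atTop,
      K * axisCov ρ L β n < |cov ρ β (plaq ρ x i j) (plaq ρ y i' j')|) :
    ¬ PackageRho ρ := by
  rintro ⟨a, Γ, β₀, ℓ₀, c, C, h⟩
  obtain ⟨K, -, hK⟩ := h.esfb
  have hev := hK (max L L')
  have hfr := hblow K
  obtain ⟨β, hβ1, hβ2⟩ := (hfr.and_eventually hev).exists
  have := (hβ2 L L' n hn hnL (le_max_left _ _) (le_max_right _ _)).2.2 x y i j i' j' hxy hij hij' hd
  linarith

/-- **Kill switch (loss of positivity).** If at `(G, ρ)` the axis covariance at some admissible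
`(L, n)` is `≤ 0` frequently as `β → ∞`, the crux fails at `(G, ρ)` (transfer-matrix positivity
gives `≥ 0` always; an exact zero infinitely often along `β → ∞` is what would be needed). -/
theorem not_packageRho_of_frequently_nonpos {L : ℕ} [NeZero L] {n : ℕ} (hn : 1 ≤ n)
    (hnL : 8 * n ≤ L) (hbad : ∃ᶠ β : ℝ in atTop, axisCov ρ L β n ≤ 0) : ¬ PackageRho ρ := by
  rintro ⟨a, Γ, β₀, ℓ₀, c, C, h⟩
  obtain ⟨β, hβ1, hβ2⟩ := (hbad.and_eventually (h.eventually_axisCov_pos hn hnL)).exists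
  linarith

end Dissection


/-! ## § LoadBearing — hypotheses of the crux that cannot be dropped -/

section LoadBearing

variable {G : Type} [Group G] [TopologicalSpace G] [IsTopologicalGroup G] [CompactSpace G]
  [MeasurableSpace G] [BorelSpace G] {N : ℕ}

/-- **Faithfulness is load-bearing**: for EVERY compact `G` the package fails for the trivial
`N`-dimensional representation (`P ≡ 0`, so every covariance vanishes while the lower bound
`c·Γ > 0` is demanded on the torus `L = 8`, femto for all large `β`). -/
theorem not_packageRho_one : ¬ PackageRho (1 : G →* Matrix (Fin N) (Fin N) ℂ) := by
  rintro ⟨a, Γ, β₀, ℓ₀, c, C, h⟩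
  haveI : NeZero (8 : ℕ) := ⟨by norm_num⟩
  obtain ⟨β, hβ, hs⟩ := ((h.eventually_femto 8).and (h.eventually_arg_mem le_rfl)).exists
  have hlow := ((h.2.2.2.2.2 8 β hβ.1 hβ.2).1 1 le_rfl (by norm_num)).1
  have hax : axisCov (1 : G →* Matrix (Fin N) (Fin N) ℂ) 8 β 1 = 0 := by
    simp only [axisCov, plaq_one]
    exact cov_zero_left _ β _
  have hΓ := (h.2.2.2.2.1 _ hs.1 hs.2).1
  have := mul_pos h.2.1 hΓ
  rw [hax, mul_zero] at hlow
  linarith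

/-- The crux with `r : LatticeRep G` replaced by a bare continuous unitary representation
(faithfulness dropped, everything else verbatim). -/
def FemtoCurvatureTwoPointUnfaithful : Prop :=
  ∀ (G : Type) [Group G] [TopologicalSpace G] [IsTopologicalGroup G] [CompactSpace G],
    IsCompactSimpleLieGroup G →
      letI : MeasurableSpace G := borel G
      haveI : BorelSpace G := ⟨rfl⟩
      ∀ (N : ℕ) (ρ : G →* Matrix (Fin N) (Fin N) ℂ), Continuous ρ →
        (∀ g, ρ g ∈ Matrix.unitaryGroup (Fin N) ℂ) → PackageRho ρ

omit [MeasurableSpace G] [BorelSpace G] in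
/-- **The unfaithful variant is false** as soon as ONE compact simple Lie group exists (the only
reason this is not unconditional: the tree proves `IsCompactSimpleLieGroup` for no concrete group
— `isSimpleCompactGroup_specialUnitaryGroup` is a named, unproved fact). -/
theorem not_unfaithful_of_isCompactSimpleLieGroup (hG : IsCompactSimpleLieGroup G) :
    ¬ FemtoCurvatureTwoPointUnfaithful := fun h => by
  letI : MeasurableSpace G := borel G
  haveI : BorelSpace G := ⟨rfl⟩
  refine not_packageRho_one (G := G) (N := 1) (h G hG 1 1 ?_ ?_)
  · exact continuous_const
  · intro g
    simp

/-- … in particular modulo the tree's named fact that `SU(n)`, `n ≥ 2`, is compact simple. -/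
theorem not_unfaithful_of_su (hSU : isSimpleCompactGroup_specialUnitaryGroup.{0}) :
    ¬ FemtoCurvatureTwoPointUnfaithful :=
  not_unfaithful_of_isCompactSimpleLieGroup
    (isCompactSimpleLieGroup_specialUnitaryGroup hSU (n := 2) le_rfl)

omit [MeasurableSpace G] [BorelSpace G] in
/-- **Refutation template.** A single compact simple Lie `G` with a faithful `r` violating the
package refutes the crux; this is where the universal blocker sits (an `IsCompactSimpleLieGroup`
instance must be PROVED for the witness group). -/
theorem not_femtoCurvatureTwoPoint_of (hG : IsCompactSimpleLieGroup G) (r : LatticeRep G)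
    (h : letI : MeasurableSpace G := borel G
      haveI : BorelSpace G := ⟨rfl⟩
      ¬ PackageRho r.ρ) :
    ¬ FemtoCurvatureTwoPoint := fun hc => h (femtoCurvatureTwoPoint_iff.1 hc G hG r)

/-- **(gen 2) The crux's `∀ G` class is provably non-empty**: `SU(n)`, `n ≥ 2`, is a compact simple
Lie group in the sense of `IsCompactSimpleLieGroup`, unconditionally (simplicity:
`isSimpleCompactGroup_specialUnitaryGroup_holds` of `GaugeGroupsProofs`; the fundamental
representation is faithful unitary continuous). So the crux is not vacuously true, and gen 1's
"no instance, no `¬`" blocker is gone. -/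
theorem isCompactSimpleLieGroup_su {n : ℕ} (hn : 2 ≤ n) :
    IsCompactSimpleLieGroup (Matrix.specialUnitaryGroup (Fin n) ℂ) :=
  isCompactSimpleLieGroup_specialUnitaryGroup
    Literature.MathematicalPhysics.QuantumLattice.isSimpleCompactGroup_specialUnitaryGroup_holds hn

/-- **(gen 2) Unconditional refutation template.** ONE faithful unitary continuous `r` of ONE
`SU(n)`, `n ≥ 2`, at which the package fails refutes the crux. (What is missing for a kill is
therefore exactly `¬ PackageRho r.ρ` for such an `r` — and § Resists explains why that is not
expected: `PackageRho` follows from the fixed-torus semiclassics `FixedTorusTwoSided`, believed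
TRUE.) -/
theorem not_femtoCurvatureTwoPoint_of_su {n : ℕ} (hn : 2 ≤ n)
    (r : LatticeRep (Matrix.specialUnitaryGroup (Fin n) ℂ))
    (h : letI : MeasurableSpace (Matrix.specialUnitaryGroup (Fin n) ℂ) := borel _
      haveI : BorelSpace (Matrix.specialUnitaryGroup (Fin n) ℂ) := ⟨rfl⟩
      ¬ PackageRho r.ρ) :
    ¬ FemtoCurvatureTwoPoint :=
  not_femtoCurvatureTwoPoint_of (isCompactSimpleLieGroup_su hn) r h

/-- … in particular the unfaithful variant (gen 1 `not_unfaithful_of_su`) is false outright. -/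
theorem not_unfaithful : ¬ FemtoCurvatureTwoPointUnfaithful :=
  not_unfaithful_of_isCompactSimpleLieGroup (isCompactSimpleLieGroup_su (n := 2) le_rfl)

end LoadBearing


/-! ## § UpperOnly — every clause except the LOWER bound is free (freezing + a slow unit map) -/

section UpperOnly

variable {G : Type} [Group G] [TopologicalSpace G] [IsTopologicalGroup G] [CompactSpace G]
  [MeasurableSpace G] [BorelSpace G] {N : ℕ}

/-- The crux body with the lower bound `c · Γ(n a) ≤ n⁸ Cov` DELETED (everything else verbatim). -/
def UpperOnlyWith (ρ : G →* Matrix (Fin N) (Fin N) ℂ) (a Γ : ℝ → ℝ) (β₀ ℓ₀ C : ℝ) : Prop :=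
  0 < ℓ₀ ∧ (∀ β, 0 < a β) ∧ Tendsto a atTop (𝓝 0) ∧
    (∀ s : ℝ, 0 < s → s ≤ ℓ₀ → 0 < Γ s ∧ Γ s ≤ 1) ∧
      ∀ (L : ℕ) [NeZero L] (β : ℝ), β₀ ≤ β → (L : ℝ) * a β ≤ ℓ₀ →
        (∀ n : ℕ, 1 ≤ n → 8 * n ≤ L →
            (n : ℝ) ^ 8 * axisCov ρ L β n ≤ C * Γ ((n : ℝ) * a β)) ∧
          ∀ (x y : Site 4 L) (i j i' j' : Fin 4), x ≠ y → i ≠ j → i' ≠ j' →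
            |cov ρ β (plaq ρ x i j) (plaq ρ y i' j')| * tdist x y ^ 8 ≤ C * Γ (tdist x y * a β)

/-- The package trivially implies its upper-only part. -/
theorem PackageWith.upperOnlyWith {ρ : G →* Matrix (Fin N) (Fin N) ℂ} {a Γ : ℝ → ℝ}
    {β₀ ℓ₀ c C : ℝ} (h : PackageWith ρ a Γ β₀ ℓ₀ c C) : UpperOnlyWith ρ a Γ β₀ ℓ₀ C := by
  obtain ⟨hℓ, -, ha, hat, hΓ, hcl⟩ := h
  refine ⟨hℓ, ha, hat, hΓ, fun L _ β hβ hL => ⟨fun n hn hnL => ((hcl L β hβ hL).1 n hn hnL).2,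
    (hcl L β hβ hL).2⟩⟩

/-- Torus distances are at most the side: `dist(x, y) ≤ L`. -/
theorem tdist_le_side {L : ℕ} [NeZero L] (x y : Site 4 L) : tdist x y ≤ L := by
  unfold tdist
  rw [Real.sqrt_le_iff]
  refine ⟨by positivity, ?_⟩
  have hk : ∀ k : Fin 4, (((x k - y k).valMinAbs : ℤ) : ℝ) ^ 2 ≤ ((L : ℝ) / 2) ^ 2 := fun k => by
    have h1 : (((x k - y k).valMinAbs.natAbs : ℕ) : ℝ) ≤ (L : ℝ) / 2 := by
      calc (((x k - y k).valMinAbs.natAbs : ℕ) : ℝ) ≤ ((L / 2 : ℕ) : ℝ) := by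
            exact_mod_cast ZMod.natAbs_valMinAbs_le (x k - y k)
        _ ≤ (L : ℝ) / 2 := Nat.cast_div_le
    have h2 : |(((x k - y k).valMinAbs : ℤ) : ℝ)| = (((x k - y k).valMinAbs.natAbs : ℕ) : ℝ) := by
      rw [← Int.cast_abs, Int.abs_eq_natAbs, Int.cast_natCast]
    have h3 : |(((x k - y k).valMinAbs : ℤ) : ℝ)| ≤ (L : ℝ) / 2 := h2 ▸ h1
    calc (((x k - y k).valMinAbs : ℤ) : ℝ) ^ 2 = |(((x k - y k).valMinAbs : ℤ) : ℝ)| ^ 2 :=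
          (sq_abs _).symm
      _ ≤ ((L : ℝ) / 2) ^ 2 := pow_le_pow_left₀ (abs_nonneg _) h3 2
  calc ∑ k : Fin 4, (((x k - y k).valMinAbs : ℤ) : ℝ) ^ 2 ≤ ∑ _k : Fin 4, ((L : ℝ) / 2) ^ 2 :=
        Finset.sum_le_sum fun k _ => hk k
    _ = (L : ℝ) ^ 2 := by simp; ring

/-- **The upper-only variant HOLDS** for every compact (second-countable) `G` and every continuous
unitary `ρ`, with `Γ ≡ 1`, `C = 1`, `ℓ₀ = 1` and a slowly decaying step unit map built from
freezing thresholds: on the torus of side `L` all plaquette covariances are `≤ L⁻⁸` once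
`β ≥ T(L)`, and `a(β) := 1/(M(β)+1)` with `M(β)` the largest `m` whose cumulative threshold is
`≤ β` makes exactly the tori `L ≤ M(β)+1` femto. So the LOWER bound `c Γ(n a) ≤ n⁸ Cov` is the
unique load-bearing clause of the crux: everything else is satisfiable with NO ultraviolet input. -/
theorem exists_upperOnlyWith [SecondCountableTopology G] (ρ : G →* Matrix (Fin N) (Fin N) ℂ)
    (hρ : Continuous ρ) (hρu : ∀ g, ρ g ∈ Matrix.unitaryGroup (Fin N) ℂ) :
    ∃ (a : ℝ → ℝ) (β₀ : ℝ), UpperOnlyWith ρ a (fun _ => 1) β₀ 1 1 := by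
  classical
  -- `good m β`: on the torus of side `m+1` every plaquette covariance is `≤ (m+1)⁻⁸` in size
  let good : ℕ → ℝ → Prop := fun m β =>
    ∀ t : (Site 4 (m + 1) × Site 4 (m + 1)) × ((Fin 4 × Fin 4) × (Fin 4 × Fin 4)),
      |cov ρ β (plaq ρ t.1.1 t.2.1.1 t.2.1.2) (plaq ρ t.1.2 t.2.2.1 t.2.2.2)| *
          (((m + 1 : ℕ) : ℝ)) ^ 8 ≤ 1
  have hE : ∀ m, ∀ᶠ β in atTop, good m β := fun m => by
    refine Filter.eventually_all.2 fun t => ?_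
    have ht := tendsto_cov_plaq ρ hρ hρu t.1.1 t.1.2 t.2.1.1 t.2.1.2 t.2.2.1 t.2.2.2
    have h8 : (0 : ℝ) < (((m + 1 : ℕ) : ℝ)) ^ 8 := by positivity
    filter_upwards [(Metric.tendsto_nhds.1 ht) _ (one_div_pos.2 h8)] with β hβ
    rw [Real.dist_eq, sub_zero, lt_div_iff₀ h8] at hβ
    exact hβ.le
  have hG : ∀ m, ∀ᶠ β in atTop, ∀ m' ∈ Finset.range (m + 1), good m' β := fun m =>
    (Filter.eventually_all_finset _).2 fun m' _ => hE m'
  choose T hT using fun m => Filter.eventually_atTop.1 (hG m)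
  -- monotone envelope of the thresholds, `T' m ≥ max (T m) m`
  let T' : ℕ → ℝ := fun m => (∑ k ∈ Finset.range (m + 1), |T k|) + m
  have hT'T : ∀ m, T m ≤ T' m := fun m => by
    have h1 : |T m| ≤ ∑ k ∈ Finset.range (m + 1), |T k| :=
      Finset.single_le_sum (fun k _ => abs_nonneg (T k)) (Finset.self_mem_range_succ m)
    have h2 := le_abs_self (T m)
    have h3 : (0 : ℝ) ≤ m := Nat.cast_nonneg m
    simp only [T']
    linarith
  have hT'm : ∀ m : ℕ, (m : ℝ) ≤ T' m := fun m => by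
    have := Finset.sum_nonneg fun k (_ : k ∈ Finset.range (m + 1)) => abs_nonneg (T k)
    simp only [T']
    linarith
  have hT'mono : ∀ {m m' : ℕ}, m ≤ m' → T' m ≤ T' m' := fun {m m'} hmm' => by
    simp only [T']
    have h1 : ∑ k ∈ Finset.range (m + 1), |T k| ≤ ∑ k ∈ Finset.range (m' + 1), |T k| :=
      Finset.sum_le_sum_of_subset_of_nonneg (Finset.range_mono (by omega))
        fun k _ _ => abs_nonneg (T k)
    have h2 : (m : ℝ) ≤ m' := by exact_mod_cast hmm'
    linarith
  -- the unit map
  let M : ℝ → ℕ := fun β => Nat.findGreatest (fun m => T' m ≤ β) ⌊β⌋₊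
  have hMspec : ∀ β, T' 0 ≤ β → T' (M β) ≤ β := fun β h0 =>
    Nat.findGreatest_spec (P := fun m => T' m ≤ β) (Nat.zero_le _) h0
  have hMge : ∀ β m, T' m ≤ β → m ≤ M β := fun β m hm =>
    Nat.le_findGreatest (Nat.le_floor ((hT'm m).trans hm)) hm
  let a : ℝ → ℝ := fun β => if T' 0 ≤ β then 1 / ((M β : ℝ) + 1) else 2
  have ha_pos : ∀ β, 0 < a β := fun β => by
    simp only [a]
    split_ifs <;> positivity
  have ha_of : ∀ β, T' 0 ≤ β → a β = 1 / ((M β : ℝ) + 1) := fun β h => by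
    simp only [a, if_pos h]
  refine ⟨a, T' 0, one_pos, ha_pos, ?_, fun s _ _ => ⟨one_pos, le_rfl⟩, ?_⟩
  · -- `a → 0`
    refine Metric.tendsto_atTop.2 fun ε hε => ?_
    obtain ⟨m, hm⟩ := exists_nat_one_div_lt hε
    refine ⟨T' m, fun β hβ => ?_⟩
    have h0 : T' 0 ≤ β := (hT'mono (Nat.zero_le m)).trans hβ
    rw [Real.dist_eq, sub_zero, abs_of_pos (ha_pos β), ha_of β h0]
    have hmM : (m : ℝ) + 1 ≤ (M β : ℝ) + 1 := by exact_mod_cast Nat.succ_le_succ (hMge β m hβ)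
    calc 1 / ((M β : ℝ) + 1) ≤ 1 / ((m : ℝ) + 1) :=
          one_div_le_one_div_of_le (by positivity) hmM
      _ < ε := hm
  · -- the clauses on a femto torus
    intro L _ β hβ0 hLa
    obtain ⟨m', rfl⟩ : ∃ m', L = m' + 1 := ⟨L - 1, (Nat.succ_pred_eq_of_ne_zero (NeZero.ne L)).symm⟩
    rw [ha_of β hβ0] at hLa
    -- femto ⇒ `m' ≤ M β` ⇒ `good m' β`
    have hLM : m' + 1 ≤ M β + 1 := by
      have h1 : ((m' + 1 : ℕ) : ℝ) ≤ (M β : ℝ) + 1 := by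
        have hpos : (0 : ℝ) < (M β : ℝ) + 1 := by positivity
        have := hLa
        rw [mul_one_div, div_le_one hpos] at this
        exact this
      exact_mod_cast h1
    have hgood : good m' β := by
      refine hT (M β) β ((hT'T _).trans (hMspec β hβ0)) m' ?_
      exact Finset.mem_range.2 (by omega)
    have hside : (0 : ℝ) ≤ ((m' + 1 : ℕ) : ℝ) := Nat.cast_nonneg _
    refine ⟨fun n hn hnL => ?_, fun x y i j i' j' _ _ _ => ?_⟩
    · have hg := hgood (((0 : Site 4 (m' + 1)), Pi.single (2 : Fin 4) ((n : ℕ) : ZMod (m' + 1))),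
        (((0 : Fin 4), (1 : Fin 4)), ((0 : Fin 4), (1 : Fin 4))))
      simp only at hg
      have hn8 : (n : ℝ) ^ 8 ≤ (((m' + 1 : ℕ) : ℝ)) ^ 8 :=
        pow_le_pow_left₀ (Nat.cast_nonneg n) (by exact_mod_cast (by omega : n ≤ m' + 1)) 8
      simp only [one_mul, axisCov]
      calc (n : ℝ) ^ 8 * cov ρ β (plaq ρ (0 : Site 4 (m' + 1)) 0 1)
              (plaq ρ (Pi.single (2 : Fin 4) ((n : ℕ) : ZMod (m' + 1))) 0 1)
            ≤ (n : ℝ) ^ 8 * |cov ρ β (plaq ρ (0 : Site 4 (m' + 1)) 0 1)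
              (plaq ρ (Pi.single (2 : Fin 4) ((n : ℕ) : ZMod (m' + 1))) 0 1)| :=
            mul_le_mul_of_nonneg_left (le_abs_self _) (by positivity)
        _ ≤ (((m' + 1 : ℕ) : ℝ)) ^ 8 * |cov ρ β (plaq ρ (0 : Site 4 (m' + 1)) 0 1)
              (plaq ρ (Pi.single (2 : Fin 4) ((n : ℕ) : ZMod (m' + 1))) 0 1)| :=
            mul_le_mul_of_nonneg_right hn8 (abs_nonneg _)
        _ ≤ 1 := by rw [mul_comm]; exact hg
    · have hg := hgood ((x, y), ((i, j), (i', j')))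
      simp only at hg
      have hd8 : tdist x y ^ 8 ≤ (((m' + 1 : ℕ) : ℝ)) ^ 8 :=
        pow_le_pow_left₀ (Real.sqrt_nonneg _) (tdist_le_side x y) 8
      simp only [one_mul]
      calc |cov ρ β (plaq ρ x i j) (plaq ρ y i' j')| * tdist x y ^ 8
            ≤ |cov ρ β (plaq ρ x i j) (plaq ρ y i' j')| * (((m' + 1 : ℕ) : ℝ)) ^ 8 :=
            mul_le_mul_of_nonneg_left hd8 (abs_nonneg _)
        _ ≤ 1 := hg

/-- The faithful-representation form (second countability is automatic). -/
theorem exists_upperOnlyWith_rep (r : LatticeRep G) :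
    ∃ (a : ℝ → ℝ) (β₀ : ℝ), UpperOnlyWith r.ρ a (fun _ => 1) β₀ 1 1 := by
  haveI : SecondCountableTopology G := secondCountable_of_latticeRep r
  exact exists_upperOnlyWith r.ρ r.continuous r.mem_unitary

end UpperOnly


/-! ## § Repairs (gen 2) — what `Continuous a` / `MonotoneOn Γ` add to the crux as typed

The crux as typed couples two data points `(L, β, n)` and `(L', β', n')` ONLY when the arguments
of `Γ` coincide, `n · a(β) = n' · a(β')` (`cross_comparable`); with a generic step unit map no two
distinct `(n, step)` ever coincide, which is the loophole (card generic-step-gamma-encoding; the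
lead's `encoding` realises it). The two repairs on the table act as follows.

* `MonotoneOn Γ (Ioc 0 ℓ₀)` turns coincidence into ORDER: `n a(β) ≤ n' a(β')` already gives
  `c · n⁸ Cov_{L,β}(n) ≤ C · n'⁸ Cov_{L',β'}(n')` (`cross_monotone`). Against a parasitic SLOW step
  map (`a_k ↓ 0` slowly, thresholds astronomically far apart) take `n = 1` at step `k` and
  `n' = k'` at a later step `k'` with `a_{k'} k' ≥ a_k`: the right side is frozen
  (`Cov_{β'} → 0` as `β' → ∞` on the fixed torus `8k'`… but `k'` grows too — what decides is
  freezing versus the growth of `n'`; for the lead's dyadic encoding `β' ≍ 2^{k'}`, `n' ≍ ladder(k')`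
  and `n'⁸ Cov_{β'}(n') ≍ β'⁻² → 0` while the left side is fixed: violated). For `a = a_AF` the
  order condition reads `Γ_phys` increasing, which holds at one loop (`Γ_phys(s) ~ g⁴(s)`).
* `Continuous a` turns coincidence into a DENSE web: for every `n < n'` and every large `β` there
  is a later `β' > β` with `n' a(β') = n a(β)` (`exists_later_level`, intermediate values), hence
  two-sided comparability of `n'⁸ Cov_{8n',β'}(n')` with `n⁸ Cov_{8n,β}(n)` (`rg_chain_of_continuous`).
  Read against fixed-torus semiclassics (`β² n⁸ Cov_{L,β}(n) → κ_{L,n} ∈ [c', C']`, the line's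
  `FixedTorusTwoSided`): `β'² ≲ (C C'/ c c') β²` would be forced for ALL `n'`, absurd as
  `n' → ∞` (`β' → ∞`) — UNLESS the approach to the fixed-torus limit is not uniform in `L = 8n'`,
  which is exactly one-loop running: `β² n⁸ Cov_β(n) = κ(1 + (b/β) log n + …) ≈ κ β² g_eff⁴(n; β)`,
  `g_eff² = 1/(β − b log n)`; along `n a(β) = s` with `a = a_AF = Λ⁻¹e^{−β/b}` the combination
  `β − b log n = b log(1/(sΛ))` is `β`-INDEPENDENT and `Γ(s) ≍ κ / (b log(1/(sΛ)))²`. So the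
  repaired crux (either repair) pins `a` to `a_AF · e^{O(1)}` and asserts RG-consistency of the
  curvature two-point function across femto boxes — the honest open problem; neither repair is
  cheaply refutable, and both kill the line's `encoding`.
-/

section Repairs

variable {G : Type} [Group G] [TopologicalSpace G] [IsTopologicalGroup G] [CompactSpace G]
  [MeasurableSpace G] [BorelSpace G] {N : ℕ} {ρ : G →* Matrix (Fin N) (Fin N) ℂ}
  {a Γ : ℝ → ℝ} {β₀ ℓ₀ c C : ℝ}

/-- **Equal arguments ⇒ two-sided comparability** — the only coupling between different
`(L, β, n)` that the crux as typed contains: if `n · a(β) = n' · a(β')` (both data admissible and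
femto) then `c · n'⁸ Cov_{L',β'}(n') ≤ C · n⁸ Cov_{L,β}(n)` (and symmetrically). -/
theorem PackageWith.cross_comparable (h : PackageWith ρ a Γ β₀ ℓ₀ c C) {L L' : ℕ} [NeZero L]
    [NeZero L'] {β β' : ℝ} {n n' : ℕ} (hβ : β₀ ≤ β) (hL : (L : ℝ) * a β ≤ ℓ₀) (hβ' : β₀ ≤ β')
    (hL' : (L' : ℝ) * a β' ≤ ℓ₀) (hn : 1 ≤ n) (hnL : 8 * n ≤ L) (hn' : 1 ≤ n') (hnL' : 8 * n' ≤ L')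
    (harg : (n : ℝ) * a β = (n' : ℝ) * a β') :
    c * ((n' : ℝ) ^ 8 * axisCov ρ L' β' n') ≤ C * ((n : ℝ) ^ 8 * axisCov ρ L β n) := by
  have hC : 0 ≤ C := h.2.1.le.trans h.c_le_C
  obtain ⟨-, hc, -, -, -, hcl⟩ := h
  have h1 := ((hcl L β hβ hL).1 n hn hnL).1
  have h2 := ((hcl L' β' hβ' hL').1 n' hn' hnL').2
  rw [← harg] at h2
  calc c * ((n' : ℝ) ^ 8 * axisCov ρ L' β' n') ≤ c * (C * Γ ((n : ℝ) * a β)) :=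
        mul_le_mul_of_nonneg_left h2 hc.le
    _ = C * (c * Γ ((n : ℝ) * a β)) := by ring
    _ ≤ C * ((n : ℝ) ^ 8 * axisCov ρ L β n) := mul_le_mul_of_nonneg_left h1 hC

/-- **Under `MonotoneOn Γ (Ioc 0 ℓ₀)`: ordered arguments ⇒ one-sided comparability.** If
`n · a(β) ≤ n' · a(β')` then `c · n⁸ Cov_{L,β}(n) ≤ C · n'⁸ Cov_{L',β'}(n')`. -/
theorem PackageWith.cross_monotone (h : PackageWith ρ a Γ β₀ ℓ₀ c C)
    (hmono : MonotoneOn Γ (Set.Ioc 0 ℓ₀)) {L L' : ℕ} [NeZero L] [NeZero L'] {β β' : ℝ} {n n' : ℕ}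
    (hβ : β₀ ≤ β) (hL : (L : ℝ) * a β ≤ ℓ₀) (hβ' : β₀ ≤ β') (hL' : (L' : ℝ) * a β' ≤ ℓ₀)
    (hn : 1 ≤ n) (hnL : 8 * n ≤ L) (hn' : 1 ≤ n') (hnL' : 8 * n' ≤ L')
    (harg : (n : ℝ) * a β ≤ (n' : ℝ) * a β') :
    c * ((n : ℝ) ^ 8 * axisCov ρ L β n) ≤ C * ((n' : ℝ) ^ 8 * axisCov ρ L' β' n') := by
  have hC : 0 ≤ C := h.2.1.le.trans h.c_le_C
  obtain ⟨-, hc, ha, -, -, hcl⟩ := h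
  have h1 := ((hcl L β hβ hL).1 n hn hnL).2
  have h2 := ((hcl L' β' hβ' hL').1 n' hn' hnL').1
  have hmem : ∀ {m M : ℕ} {b : ℝ}, 1 ≤ m → 8 * m ≤ M → (M : ℝ) * a b ≤ ℓ₀ →
      (m : ℝ) * a b ∈ Set.Ioc 0 ℓ₀ := fun {m M b} hm hmM hMb => by
    have hm' : (0 : ℝ) < m := by exact_mod_cast hm
    refine ⟨mul_pos hm' (ha b), le_trans ?_ hMb⟩
    exact mul_le_mul_of_nonneg_right (by exact_mod_cast (by omega : m ≤ M)) (ha b).le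
  have hΓ := hmono (hmem hn hnL hL) (hmem hn' hnL' hL') harg
  calc c * ((n : ℝ) ^ 8 * axisCov ρ L β n) ≤ c * (C * Γ ((n : ℝ) * a β)) :=
        mul_le_mul_of_nonneg_left h1 hc.le
    _ ≤ c * (C * Γ ((n' : ℝ) * a β')) :=
        mul_le_mul_of_nonneg_left (mul_le_mul_of_nonneg_left hΓ hC) hc.le
    _ = C * (c * Γ ((n' : ℝ) * a β')) := by ring
    _ ≤ C * ((n' : ℝ) ^ 8 * axisCov ρ L' β' n') := mul_le_mul_of_nonneg_left h2 hC

/-- **Under `MonotoneOn Γ`: no freezing faster than the femto ceiling grows.** For every witness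
with a monotone shape, at all large `β` and every LATER `β' ≥ β`: if `n'` lattice units at `β'` are
at least one lattice unit at `β` in physical size (`a(β) ≤ n'·a(β') ≤ 2a(β)`, e.g.
`n' = ⌈a(β)/a(β')⌉`), then the rescaled axis covariance at `(8n', β', n')` is bounded BELOW by
`(c/C)·Cov_{8,β}(P_0^{01}, P_{e₂}^{01})`. A parasitic slow step map (thresholds far apart, `a`
decaying slowly) violates this: `n'` stays small while `Cov_{8n',β'} → 0` freezes; for `a = a_AF`
it reads `Γ_phys(n' a(β')) ≳ Γ_phys(a(β))`, i.e. `Γ_phys` almost increasing (true at one loop). -/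
theorem PackageWith.no_fast_freezing_of_monotone (h : PackageWith ρ a Γ β₀ ℓ₀ c C)
    (hmono : MonotoneOn Γ (Set.Ioc 0 ℓ₀)) :
    ∀ᶠ β in atTop, ∀ (β' : ℝ) (n' : ℕ) [NeZero (8 * n')], β ≤ β' → 1 ≤ n' →
      a β ≤ (n' : ℝ) * a β' → (n' : ℝ) * a β' ≤ 2 * a β →
        c * axisCov ρ 8 β 1 ≤ C * ((n' : ℝ) ^ 8 * axisCov ρ (8 * n') β' n') := by
  haveI : NeZero (8 : ℕ) := ⟨by norm_num⟩
  obtain ⟨B, hB⟩ := Filter.eventually_atTop.1 (h.eventually_femto 16)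
  filter_upwards [Filter.eventually_ge_atTop B] with β hβB β' n' _ hββ' hn' hlo hhi
  have hβ := hB β hβB
  have hβ'f := hB β' (hβB.trans hββ')
  have ha := h.2.2.1
  have h8 : ((8 : ℕ) : ℝ) * a β ≤ ℓ₀ := by
    have := hβ.2; push_cast at this ⊢; nlinarith [ha β]
  have h8' : ((8 * n' : ℕ) : ℝ) * a β' ≤ ℓ₀ := by
    have := hβ.2; push_cast at this ⊢; nlinarith [ha β]
  have key := h.cross_monotone hmono hβ.1 h8 hβ'f.1 h8' le_rfl le_rfl hn' le_rfl
    (by simpa using hlo)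
  simpa using key

omit [Group G] [TopologicalSpace G] [IsTopologicalGroup G] [CompactSpace G] [MeasurableSpace G]
  [BorelSpace G] in
/-- **Intermediate values of a continuous unit map.** If `a` is continuous, positive and tends
to `0`, every level `t ∈ (0, a(β))` is attained at some LATER coupling `β' > β`. -/
theorem exists_later_level (hcont : Continuous a) (hat : Tendsto a atTop (𝓝 0)) (β : ℝ) {t : ℝ}
    (ht0 : 0 < t) (ht : t < a β) : ∃ β' : ℝ, β < β' ∧ a β' = t := by
  obtain ⟨B, hBt, hβB⟩ := ((hat.eventually (Iio_mem_nhds ht0)).and (eventually_gt_atTop β)).exists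
  obtain ⟨x, hx, hxt⟩ :=
    intermediate_value_Icc' hβB.le hcont.continuousOn ⟨(le_of_lt hBt), ht.le⟩
  refine ⟨x, lt_of_le_of_ne hx.1 ?_, hxt⟩
  rintro rfl
  exact absurd hxt (ne_of_gt ht)

/-- **RG-consistency skeleton under `Continuous a`.** For every witness with a continuous unit
map and every `1 ≤ n < n'`: at all large `β` there is a later `β' > β` with `n' · a(β') = n · a(β)`
at which the rescaled axis covariance on the torus `8n'` is two-sidedly comparable (constants
`c/C`, `C/c`) with the one at `(8n, β, n)`. (The fixed-torus `β⁻²` law then forces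
`β' = β + O(log(n'/n))`-type running, i.e. `a ≍ a_AF`: module docblock of this section.) -/
theorem PackageWith.rg_chain_of_continuous (h : PackageWith ρ a Γ β₀ ℓ₀ c C) (hcont : Continuous a)
    {n n' : ℕ} [NeZero (8 * n)] [NeZero (8 * n')] (hn : 1 ≤ n) (hnn' : n < n') :
    ∀ᶠ β in atTop, ∃ β' : ℝ, β < β' ∧ (n' : ℝ) * a β' = (n : ℝ) * a β ∧
      c * ((n' : ℝ) ^ 8 * axisCov ρ (8 * n') β' n') ≤ C * ((n : ℝ) ^ 8 * axisCov ρ (8 * n) β n) ∧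
      c * ((n : ℝ) ^ 8 * axisCov ρ (8 * n) β n) ≤ C * ((n' : ℝ) ^ 8 * axisCov ρ (8 * n') β' n') := by
  have ha := h.2.2.1
  filter_upwards [h.eventually_femto (8 * n)] with β hβ
  have hn0 : (0 : ℝ) < n := by exact_mod_cast hn
  have hn'0 : (0 : ℝ) < n' := by exact_mod_cast (show 0 < n' by omega)
  have hlt : (n : ℝ) / n' * a β < a β := by
    have hq : (n : ℝ) / n' < 1 := (div_lt_one hn'0).2 (by exact_mod_cast hnn')
    have := ha β
    nlinarith
  obtain ⟨β', hββ', hβ't⟩ :=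
    exists_later_level hcont h.2.2.2.1 β (mul_pos (div_pos hn0 hn'0) (ha β)) hlt
  have harg : (n' : ℝ) * a β' = (n : ℝ) * a β := by
    rw [hβ't]; field_simp
  have hβ'0 : β₀ ≤ β' := hβ.1.trans hββ'.le
  have hfem' : ((8 * n' : ℕ) : ℝ) * a β' ≤ ℓ₀ := by
    have e : ((8 * n' : ℕ) : ℝ) * a β' = ((8 * n : ℕ) : ℝ) * a β := by push_cast; linarith [harg]
    rw [e]; exact hβ.2
  exact ⟨β', hββ', harg,
    h.cross_comparable hβ.1 hβ.2 hβ'0 hfem' hn le_rfl (by omega) le_rfl harg.symm,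
    h.cross_comparable hβ'0 hfem' hβ.1 hβ.2 (by omega) le_rfl hn le_rfl harg⟩

end Repairs


/-! ## § LineGSGE3 — gen 3: the reshape-2 stubs of line `generic-step-gamma-encoding` (lead c2)

Registered sorries after reshape 2 (skeleton `Lines/generic_step_gamma_encoding.lean`, 2026-08-16T16:07Z):
GD-dom `stub_axisGaussianDomination`, REST `stub_diagUpperRest` (core); RPCS `stub_plaquetteProductRPCS`,
CHESS `stub_chessboard_of_RPCS` (landed p114052; even twin p114602), VAR
`stub_variance_of_chessboard_doubling`, DBL `stub_doubling_of_RV` (landed p114599), RV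
`stub_wilsonPartitionRV` (named fact, Literature p112493). Adversarial audit (desk + small models):

* RV (`WilsonPartitionRegularVariation`, `∀ G r L`): TRUE as typed for every admissible datum — a
  faithful continuous finite-dimensional unitary `r` forces `G` Hausdorff, hence (compact) a compact LIE
  group (possibly finite / disconnected); `S ≥ 0` is real-analytic on the compact analytic manifold `G^E`
  with `S(1) = 0` attained and Haar has an analytic positive density, so AGV II Thm 7.6 / Watanabe Thm 7.1
  give `Z_L(β) ~ C β^{-λ}(log β)^{m-1}`, `C > 0`; finite `G`: `λ = 0`, `m = 1` (`Z → #flat/|G|^E`);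
  `L = 1` (one-site commutator integral) is covered by the same theorem. No junk instance.
* DBL: consistent (`λ_L ≤ dim(G^E)/2` from the Gaussian lower bound; finite `G`: ratio `→ 1`).
* RPCS (`Even L`): standard site/link reflection positivity of Wilson's action; at `L = 2` the site
  reflection is the identity of `ℤ/2` and the inequality degenerates to a conditional Cauchy–Schwarz,
  still true; `β = 0` sanity for `ℤ₂` (plane families factor over slices, full-slice cycles only):
  equality for transverse reflections, slack `b^{L²} ≥ 0` for in-plane ones. No attack.
* CHESS / VAR: the dyadic (even) restriction on `L` is NECESSARY at the stated generality (all compact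
  `G`): `Negative.ChessboardOddTorus.plaquetteChessboard_allTori_false` (p116010) — on an odd torus the
  `ℤ₂` theory has NO fully frustrated plane family (parity identity below), so for `f = min |·| 2`,
  `E ∏_x f(P_x) = 0 < E f(P_0)` at every `β`. For CONNECTED `G` there is no parity obstruction (`SU(2)`:
  the constant quaternion configuration `U(x,0) ≡ iσ₁, U(x,1) ≡ iσ₂` frustrates every plaquette of every
  torus), so this says nothing about VAR/REST for Lie `G`; it says the odd tori of REST are out of reach
  of RP + chessboard for general `G` (RP itself needs `L` even).
* VAR: consistent (`β² E P² ≤ 16 e^{A−2}` from CHESS + AM–GM + `E S^{2m} ≤ (4m/(eβ))^{2m} Z(β/2)/Z(β)`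
  + DBL); finite `G` satisfy it by freezing.
* REST / GD-dom (core): no cheap attack. `L = 1` is the one-site model (every mode "constant"): for
  `SU(2)` the `D = 4` Yang–Mills matrix integral is log-divergent (Austing–Wheater: the bosonic integral of
  `𝔤` converges iff `D > 2(d−r)/(d−2r)`, i.e. `D ≥ 5` for `𝔰𝔲(2)`, `D ≥ 4` for `𝔰𝔲(3)`, `D ≥ 3` for
  `𝔰𝔲(N ≥ 4)`; on the torus the one-loop toron density near the trivial connection is `τ^{6r−2d−1}dτ`:
  log-valley for rank 1, core `|c| ≍ (βL⁴)^{-1/4}` of full mass for rank `≥ 2` — agreeing with the lead's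
  blueprint (B3)/(B4)); in both regimes `E P = Θ(β⁻¹)` and `Var P`, `Cov` are `Θ(β⁻²)` (relative
  corrections `O(1/log β)` for rank 1), so the variance clause of REST at `L = 1, 2` and the free
  thresholds are consistent. Joint sufficiency of the stubs is kernel-checked by the lead
  (`FemtoCurvatureTwoPoint_of`); the composition closes the crux AS TYPED through the loophole — gen 1/2
  verdict unchanged (misstated by loophole, not false; honest content needs `MonotoneOn Γ` /
  `Continuous a`, § Repairs).
-/

section LineGSGE3

variable {d L : ℕ} [NeZero L] {G : Type*} [CommGroup G]

/-- **Parity identity** (abelian gauge group): the product of the `(i,j)`-plaquette holonomies over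
all base points of the torus is `1` — every link enters once directly and once inverted. (Landed:
`Negative.ChessboardOddTorus.prod_plaquetteHolonomy_eq_one`, p116010.) -/
theorem parity_prod_plaquetteHolonomy (U : GaugeConfig d L G) (i j : Fin d) :
    ∏ x : Site d L, plaquetteHolonomy U x i j = 1 := by
  have h1 : ∏ x : Site d L, U (x.shift i, j) = ∏ x : Site d L, U (x, j) :=
    Fintype.prod_equiv (Equiv.addRight (Pi.single i (1 : ZMod L) : Site d L)) _ _ (fun _ => rfl)
  have h2 : ∏ x : Site d L, U (x.shift j, i) = ∏ x : Site d L, U (x, i) :=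
    Fintype.prod_equiv (Equiv.addRight (Pi.single j (1 : ZMod L) : Site d L)) _ _ (fun _ => rfl)
  simp only [plaquetteHolonomy, Finset.prod_mul_distrib, Finset.prod_inv_distrib, h1, h2]
  rw [mul_comm (∏ x : Site d L, U (x, i)) (∏ x : Site d L, U (x, j)), mul_inv_cancel_right,
    mul_inv_cancel]

/-- Hence a CONSTANT plane family `U_{p(x;i,j)} ≡ g` forces `g ^ L^d = 1`: on an ODD torus a `ℤ₂`
theory (`g² = 1 ≠ g`) has no fully frustrated plane family — the parity obstruction behind
`Negative.ChessboardOddTorus.plaquetteChessboard_allTori_false` (CHESS / VAR need `L` even). -/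
theorem pow_card_eq_one_of_const_plaquette (U : GaugeConfig d L G) (i j : Fin d) {g : G}
    (h : ∀ x : Site d L, plaquetteHolonomy U x i j = g) : g ^ L ^ d = 1 := by
  have hp := parity_prod_plaquetteHolonomy U i j
  simp only [h, Finset.prod_const, Finset.card_univ] at hp
  have hcard : Fintype.card (Site d L) = L ^ d := by simp [Site, ZMod.card]
  rwa [hcard] at hp

end LineGSGE3


/-! ## § Resists — why the crux itself is not killed (gen 1 + gen 2), and what would kill it

1. **The `¬` is now unconditional in form, and still out of reach in substance.** Gen 1's blocker
   ("the tree proves `IsCompactSimpleLieGroup` for no concrete group") is gone: `SU(n)`, `n ≥ 2`,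
   is provably compact simple Lie (`isCompactSimpleLieGroup_su`, from `GaugeGroupsProofs`), so a
   kill is EXACTLY `¬ PackageRho r.ρ` for one faithful `r` of one `SU(n)`
   (`not_femtoCurvatureTwoPoint_of_su`). All lemmas of this file are stated for ONE arbitrary
   compact group and continuous unitary `ρ` and apply verbatim.
2. **The loophole makes the crux nearly unfalsifiable.** `a` and `Γ` are existential and `Γ` is
   pointwise-free, so (card generic-step-gamma-encoding, triage r1) a generic-valued step unit map
   decouples all `(β, n)`: the only couplings that survive are those at the SAME `β` and the same
   integer distance `n` — `eventually_ratio` and `eventually_axis_comparable` are exactly these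
   residual constraints (`cross_comparable` is the general form: equal ARGUMENTS of `Γ`), and
   `eventually_axisCov_pos` / `tendsto_gamma` the residual asymptotic ones. The lead has meanwhile
   PROVED the converse direction (`Lines/generic_step_gamma_encoding.lean`, `encoding :
   FixedTorusTwoSided → ∀ G r, CruxAt r`, sorry-free, dyadic generic step map `a(β) ≈
   1/ladder(⌊log₂ β⌋)` built from per-torus thresholds): the crux as typed FOLLOWS from fixed-torus
   two-sided `β⁻²` asymptotics with `L`-uniform constants and FREE thresholds `B(L)` — a statement
   with no unit map, no shape and no ultraviolet content. A kill must therefore be found in the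
   `β → ∞` asymptotics of finitely many FIXED small tori: either (a) `Cov_{L,β}(P_0^{01},
   P_{ne₂}^{01}) ≤ 0` frequently as `β → ∞` for one `(L, n)` (excluded in sign by transfer-matrix
   positivity — LANDED by the lead, `Theorems/…AxisCovNonneg`, `0 ≤ Cov` for all `β ≥ 0, L, n` —
   and at leading order by Wick: `2 c_r² Σ |K_L(ne₂)|² β⁻² > 0`, kernel band `[0.68, 1.81]/π²n⁴`
   LANDED as Literature `MaxwellKernelBand`), or (b) an unbounded ratio `|Cov_{L'}(pair at distance
   n)| / Cov_L(axis n)` at equal `β` — i.e. DIFFERENT leading powers of `β` for two plaquette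
   covariances. For a compact LIE group both are `β⁻² ×` (Gaussian kernel)² at leading order on
   every torus `L ≥ 2` (constant/toron modes shift coefficients by `O(L⁻⁴K)`, `O(L⁻⁸)`, both
   `≥ 0` on the axis — the cross term `K(x−y)·βE|Φ|²` with `E[Φ^aΦ^b] = φδ^{ab}` PSD by global
   gauge invariance, and the variance `β²Var(E[P|c])`; for `SU(2)` the marginal valley of the
   `D = 4` Yang–Mills matrix integral (Austing–Wheater: divergent for `N = 2, D = 4`, log-regulated
   on the compact moduli at `|θ| ≍ β^{−1/4}`) puts `log β` on `Z` and `O(1/log β)` on sub-leading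
   terms only — the `θ`-law drifts to `0⁺` in probability, where charged constant modes have the
   `θ`-INDEPENDENT `⟨|F_const|²⟩ ~ 1/(βL⁴)` — so `lim β²Cov_L` exists for every compact Lie `G`),
   so no kill is expected; the Monte-Carlo ratio test probes (b) non-perturbatively: SU(2) heat-bath,
   defining representation, distance-1 plaquette pairs in all eight geometric classes on
   `L' ∈ {2, 4, 8}` against the axis pair on `L = 8` at equal `β` (gen 1 jobs j008430, j008432,
   j014620, j014621; `β_std = 3, 6, 12, 24`): `β² Cov₈(axis, 1)` = 0.01047, 0.00823, 0.00763,
   0.00735 (→ tree 0.0071 from above); max ratio = 2.97, 3.84, 4.15, 4.31 (always `L' = 2`, class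
   B; increments +0.87, +0.31, +0.16 per doubling — the saturating `O(L⁻⁴)` toron share of the `2⁴`
   torus); shared-link class on `L' = 8`: 1.83, 2.19, 2.32, 2.39; axis comparability `Cov₄/Cov₈` =
   0.988, 0.994, 0.999, 1.03 and `Cov₂/Cov₈` = 2.20, 2.57, 2.84, 2.95; every other class `≤ 1.03`.
   All ratios are `O(1)` and convergent in `β`: `eventually_ratio` / `eventually_axis_comparable`
   hold numerically for `SU(2)` with `C/c ≈ 5`. INDEPENDENT AND STRONGER (drefute seat, kit job
   j013387, file `DREFUTE-gsge-stub-pairUpper.md` of this crux directory): on the tiniest tori the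
   all-pairs sup functional `M(L, β) = max β²|Cov| dist⁸` is FLAT over three decades of `β` —
   `M(2, β) ∈ [0.36, 0.47]` for `β = 4 … 4096`, `M(3, β) = 0.270 … 0.275` for `β = 16 … 1024` —
   and `β² Var P` is flat or decreasing on every `L`. So (b) does not fire for `SU(2)` even where
   the constant-mode sector is largest. Gen 2 adds no further compute: the question is settled
   at the level a refuter can reach.
3. **Finite gauge groups ARE killed by (b)** — `ConnectedSpace G` (inside `IsSimpleCompactGroup`)
   is load-bearing, PROVED: chain `Theorems/FemtoCurvatureTwoPoint/Negative/FiniteGroup{Peierls,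
   Vortices,TwoPlaquettes,Bounds,Ratio}` (gen 1, all ACCEPTED) + `FiniteGroupSharedLink` (gen 2,
   p110484: explicit rates `Cov_axis ≤ M₁ε⁸`, `δ²ε⁶/2 − M₂ε⁸ ≤ Cov_pair` on `(ℤ/8)⁴`) + CAPSTONE
   `FiniteGroupFalse` (gen 2; `packageBody_false_of_finite` — for EVERY finite abelian non-trivial
   `G` and faithful unitary `ρ` the crux body is false; `femtoCurvatureTwoPoint_nontrivial_false` —
   the crux with `IsCompactSimpleLieGroup G` weakened to `Nontrivial G` is FALSE, witness `ℤ₂` with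
   its defining character; rc 0 / standard axioms in the refuter's folder, lands once
   `FiniteGroupSharedLink` is built). Mechanism, in the tree's vortex-gas language: with
   `ε = e^{-βδ}` (`δ` the minimal action gap) the shared-link pair `(P_0^{02}, P_{e₂}^{01})` has
   `Cov ≥ δ²ε⁶/2 - O(ε¹⁰)` (single-link excitation, `6` frustrated plaquettes), while the axis pair
   `(P_0^{01}, P_{e₂}^{01})` has `Cov ≤ E[P P'] = O(ε⁸)`; both pairs have torus distance `1`, so the
   shared `Γ` (`cross_comparable` at `L = L' = 8`, `n = 1`) is violated. Downstream: drefute's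
   `Negative.AxisLowerFiniteGroup` (p83506) kills the `Nontrivial`-variant of the old stub
   `stub_axisLower`, and gen 2's `Negative.AxisGaussianLowerFiniteGroup` (p110557) kills the
   `Nontrivial`-variant of the line's CURRENT open stub GD⁻ (`stub_axisGaussianLower`: kernel side
   `κ K_8(e₂)² ≥ κc² > 0` by the landed band, covariance side `β² M e^{−8βδ} → 0`).
4. **Faithfulness is load-bearing** (`not_packageRho_one`; unconditional form
   `Negative.UnfaithfulFalseSU`, p110092), trivially; nothing else in the hypotheses is:
   `a → 0` only serves to make every torus eventually femto (`eventually_femto`), and every clause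
   except the LOWER bound `c Γ ≤ n⁸ Cov` is satisfiable by freezing alone with a slow unit map
   (`exists_upperOnlyWith`, PROVED). NOT load-bearing at the level of truth (gen 2 desk remark):
   non-abelian-ness / simplicity — compact `U(1)` (Wilson or Villain) satisfies ESFB
   semiclassically (free Maxwell fluctuations around flat torons with UNIFORM holonomy law and
   `θ`-independent fluctuation operator: `lim β²Cov_L(x, y) = K_L(x−y)²/2`, positive on the axis,
   `dist⁻⁸`-bounded), hence, via the lead's `encoding`, the crux BODY holds at `(U(1), z ↦ z)`
   modulo the same fixed-torus semiclassics — the clearest statement that the crux as typed has no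
   asymptotic-freedom content. (Not a Lean target: it needs the semiclassical expansion.)
5. **Net dissection.** crux at `(G, ρ)` ⟹ `ESFB ρ` (`PackageWith.esfb`) ⟸⟹ fixed-torus
   statements; `FixedTorusTwoSided ⟹ crux` (lead). So the crux as typed is TRUE at `(G, ρ)` iff
   the leading-order fixed-torus semiclassics of plaquette covariances has (i) non-vanishing axis
   coefficients for all `L ≥ 8n`, (ii)/(iii) coefficient ratios bounded uniformly in
   `(L, L', n, pair)` — no ultraviolet / multiscale statement is involved. The adversary's verdict
   (gen 1, confirmed gen 2): misstated (loophole) rather than false; not refutable; the honest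
   content needs `MonotoneOn Γ` or `Continuous a`.
6. **Repairs pre-attacked (§ Repairs, checked).** `MonotoneOn Γ (Ioc 0 ℓ₀)` ⇒ `Γ(0⁺) = 0`
   (`tendsto_gamma_nhdsWithin_zero`) and ORDER coupling (`cross_monotone`): `n a(β) ≤ n' a(β')`
   ⇒ `c n⁸Cov_β(n) ≤ C n'⁸Cov_{β'}(n')` — within one `β` this is almost-monotonicity of the
   rescaled profile (tree level `n⁸·2|K|²` = 0.0095, 0.067, 0.067, 0.048, 0.035 → 2/π⁴ = 0.0205,
   drop factor ≤ 3.3, consistent), ACROSS couplings it kills every parasitic slow step map (later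
   step, larger `n'`, frozen covariance) and for `a_AF` demands `Γ_phys` increasing (true at one
   loop); `Continuous a` ⇒ a dense web of equal-argument couplings (`rg_chain_of_continuous`: every
   `n < n'`, every large `β`, some later `β'`), which against the fixed-torus `β⁻²` law is
   consistent ONLY through one-loop running (`β − b log n` constant along `n a(β) = s`), i.e.
   `a = a_AF · e^{O(1)}`. Either repair is the honest femto continuum limit with observables
   (open, not cheaply refutable) and either breaks the line's `encoding`.
7. **Infra note for the operator / next seat.** The accepted module `Negative.FiniteGroupRatio`
   (p79223) has no hub olean (`remote:stale:…:unbuilt` for > 10 h): files importing it cannot be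
   checked or landed (six gen-1 capstone bounces "gate restarted while in flight"); use
   `Negative.FiniteGroupSharedLink` instead.
8. **Gen 3 (2026-08-16, line at lead c2 / reshape 2).** No new attack surface on the crux itself:
   the reshape only factors the fixed-torus core (`FixedTorusDiagonalSemiclassics` = GD-dom ∧ REST)
   behind provable RP/chessboard/regular-variation rungs, all consistent (§ LineGSGE3). Landed: the
   parity obstruction `Negative.ChessboardOddTorus` (p116010) — the chessboard rung cannot be stated
   for odd `L` at the generality "all compact `G`", so REST's odd tori genuinely need the semiclassics
   (or connectedness); re-filed: the finite-group CAPSTONE `Negative.FiniteGroupFalse` (p115747,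
   `femtoCurvatureTwoPoint_nontrivial_false`, `cruxBody_false_of_finite`; parked on the unbuilt olean of
   `FiniteGroupSharedLink` — operator: `Negative.FiniteGroupRatio` (p79223, 04:32Z) and the three gen-2
   modules (p110092, p110484, p110557, ~15:00Z) still have no hub olean at 16:45Z while the lead's
   p110989/p111302 built within 11 minutes; a 545-line self-contained twin checks rc 0 but exceeds the
   400-line lint). What would still kill the crux is unchanged (item 2): a violation of
   `eventually_ratio` / `eventually_axisCov_pos` in the `β → ∞` asymptotics of one fixed small torus
   for `SU(N)` — excluded at leading order (both sides `Θ(β⁻²)`, rank-1 log only on `Z`) and numerically.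
-/

end Summit.QuantumFields.YangMills.Cruxes.FemtoCurvatureTwoPoint.Disproof

end
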